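import Summits.CriticalPhenomena.Ising3DConformalLimit.Theses.HyperoctahedralRP
import Summits.CriticalPhenomena.Ising3DConformalLimit.Theses.PlanarCornerRotations
import Summits.CriticalPhenomena.Ising3DConformalLimit.Theses.PositivityBegetsConformality
import Summits.CriticalPhenomena.Ising3DConformalLimit.Theses.ConformalPoissonDevice
import Summits.CriticalPhenomena.Ising3DConformalLimit.Theses.MonotoneRG
import Summits.CriticalPhenomena.Ising3DConformalLimit.Theorems.MoebiusLimitExists.Negative.FreeTranslations
import Summits.CriticalPhenomena.Ising3DConformalLimit.Theorems.MoebiusLimitExists.Negative.ScaleRedundant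
import Summits.CriticalPhenomena.Ising3DConformalLimit.Theorems.MoebiusLimitExists.Negative.ScaleFree
import Summits.CriticalPhenomena.Ising3DConformalLimit.Theorems.MoebiusLimitExists.Negative.TwoPointPositivity
import Summits.CriticalPhenomena.Ising3DConformalLimit.Theorems.MoebiusLimitExists.Negative.MeshContinuity
import Summits.CriticalPhenomena.Ising3DConformalLimit.Theorems.MoebiusLimitExists.Negative.OnlyInteractionTightness
import Summits.CriticalPhenomena.Ising3DConformalLimit.Theorems.MoebiusLimitExists.Negative.LocalBoundsDoubling
import Literature.Probability.LatticeModels.PointwiseScalingLimitScale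
import Literature.Probability.LatticeModels.PointwiseScalingLimitEtaExists
import Literature.Probability.LatticeModels.CriticalUrsellFourSign
import Mathlib.Analysis.SpecialFunctions.Log.Base

/-!
# Disproof work file — crux `ExistsScaleCovariantLimit` (item stmt-CriticalPhenomena-1981), cycle 2

Standing crux disprover (`cdisprove`, D-0016), route `HyperoctahedralRP` r4 (shared verbatim by
`PlanarCornerRotations`, `PositivityBegetsConformality`, `ConformalPoissonDevice`, and as item 1981 by
≥ 14 further route files; TARGET of route `MonotoneRG`). The crux:
`∃ ρ Δ S, ρ > 0 on (0,1] ∧ 0 < Δ ∧ HasPointwiseScalingLimit (criticalCorr 3) ρ S ∧ S = 0 off NonCoincident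
 ∧ IsNondegenerateTwoPoint S ∧ IsTranslationInvariant S ∧ IsScaleCovariant Δ S`.

VERDICT (cycle 2): NOT REFUTED. The crux is — provably, §A — EXACTLY the open existence problem for the
full continuum limit of the critical `ℤ³` spin correlations (Duminil-Copin, ICM 2022, §8.4 p. 29,
"widely open"); no formalisation loophole survives (junk audit of cycle 1 re-checked: `n = 0` gives
`S₀ ≡ 1` consistently, odd `n` vanish by `m*(β_c) = 0`, coincident locus killed by the normalisation
clause, `β_c` and the `limUnder` states are the true ones by `criticalCorr_wellDefined_holds`, the floor
discretisation's coordinate hyperplanes are harmless by FREE translation invariance).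

## Findings (all kernel-checked, sorry-free; provers: import the landed `Negative/` copies)

* §A `iff_limit_nondeg`, `iff_pure_existence`, `not_crux_iff`: **crux ⟺ ∃ ρ S, limit ∧ S₂ ≢ 0 on
  NonCoincident** — `ρ > 0`, `0 < Δ`, normalisation, translation invariance (tree `FreeTranslations`,
  no continuity needed), scale covariance (tree `ScaleFree`/`exists_rpow_scale_mem_Icc`) and
  non-degeneracy beyond ONE pair (`TwoPointPositivity`) are ALL FREE. A disproof must show: every
  full-filter pointwise limit of `criticalCorr 3`, under any renormalisation, has `S₂ ≡ 0`.
  `continuousOn_of_clauses`: continuity of the limit is free too (mesh continuity).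
* §B position: `shared_*` (`Iff.rfl` with the three sibling route decls); `of_euclideanLimit`,
  `of_moebiusLimit` (1344), `of_conjunct`; `RotationUpgrade` and
  `euclideanLimit_iff_crux_and_rotationUpgrade` (**item 0638 = crux ∧ "limits are isotropic"**; some
  limit isotropic ⟺ all are, by uniqueness up to scale); `limitRotationInvariant_iff`
  (**item 1980 ⟺ (HRP2Rigidity → RotationUpgrade)** — its normalisation/TI/scale hypotheses are idle).
* §C `Δ` is an OUTPUT: `delta_mem_Icc_of_clauses` (`Δ ∈ [1/2, 3/4]`, DCP 2025 Thm 1.5 via the forced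
  existence of `η`), refuted strengthenings `not_crux_with_delta_gt_threeQuarters` (NEW; cycle 1 had
  `> 1`), `…_lt_half`, `not_crux_with_planar_delta` (`Δ = 1/8`); `delta_unique` across ALL witnesses,
  `crux_iff_existsUnique_delta`; `crux_implies_eta_exists` (a `ρ`/`Δ`/`S`-free LATTICE consequence:
  `η ∈ [0,1/2]` exists), `delta_eq_of_eta` (`Δ = (1+η)/2`). NOT refutable today: `Δ = 1/2` (i.e.
  `η = 0`; only `η ≥ 0` is rigorous).
* §D `ρ`-free forms: `hasPointwiseScalingLimit_rhoPin` (full filter), **`iff_pinned`: crux ⟺ the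
  pinned zoom `⟨σ₀σ_{⌊1/δ⌋e₀}⟩^{-n/2}⟨∏σ_{[xᵢ/δ]}⟩` converges** (no unknown constant left);
  refutation criteria on the lattice: `axis_ratio_tendsto` (`⟨σ₀σ_{⌊sm⌋e₀}⟩/⟨σ₀σ_{me₀}⟩ → s^{-2Δ}`:
  axis regular variation; a log-periodic modulation refutes), `fourPoint_ratio_tendsto` +
  `fourRatio_smul`/`fourRatio_translate` (the RAW ratio `G₄/(G₂G₂)` at `[x/δ]` converges to a
  dilation-INVARIANT `Q(x)` — a Monte-Carlo-accessible, constant-free observable).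
* §E LOAD-BEARING (NEW): the discretely self-similar family `W_ε(z) = ‖z‖_∞⁻¹ exp(ε sin(2π log₂‖z‖_∞))`.
  `no_limit_of_hasDsiPair`: ANY lattice family with pair function `W_ε` (higher orders arbitrary, e.g.
  its Wick completion) has NO non-degenerate full-filter pointwise limit under ANY renormalisation
  (`sin(2π log₂ 3) ≠ 0`: the constant-free ratio `W(⌊3/δ⌋e₀)/W(⌊1/δ⌋e₀)` has different limits along
  `2^{-j}` and `(3·2^j)⁻¹`); yet `dsi_dyadic_tendsto`: its DYADIC scaling limit (`ρ = δ^{-1/2}`) exists at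
  every pair, positive, continuous, translation invariant, `2`-covariant (`dsiLimitTwo_two_smul`) and
  `3`-covariant for no exponent (`dsiLimitTwo_not_three_covariant`); and `W_ε` shares with
  `criticalCorr 3`: lattice TI, odd orders `0`, symmetric pair function invariant under the lattice
  point group, `0 < G₂ ≤ 1`, BOTH rigorous power bounds `c‖z‖⁻² ≤ G₂ ≤ C‖z‖⁻¹`
  (`exists_discretelySelfSimilar_family` packages it definition-free; `not_cruxShape_of_hasDsiPair`).
  READING: the full filter `𝓝[>] 0` is where the Ising input is consumed; a proof must use something
  outside {TI, point group, positivity, the two power bounds, sequential compactness}. On paper (not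
  formalised): `W_ε` is also sup-norm-radially decreasing for `|ε| < ln 2/(2π)` (MMS-type monotonicity
  survives), and a log-periodically modulated power spectrum `|k|^{2Δ-3}(1+ε cos(ω log|k|))` is
  Stieltjes in every pencil for small `ε` (reflection positivity in ALL directions survives at the
  two-point level — card `rp-cannot-fix-the-scale-log-periodic`); its Gaussian field is TI, O(3), RP,
  `2`-self-similar, not scale invariant, and NOT germ-Markov (`1/f̂` not polynomial) — so among the
  surviving crux ideas only a lever using the DLR/Markov/geometric (currents, FK) structure of the n.n.
  measure, beyond two-point axiomatics, can bite (consistent with triage r1: `markov-zoom-rigidity`).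
* §F Targets: none this cycle (no line picked, `stuck_stubs = []`).
* §H (NEW) the ω-limit formulation: `PinnedPrecompact` (tightness: every mesh sequence has a
  subsequence along which the pinned zoom converges for all `n`) and `PinnedUniqueClusterPoint`;
  **`crux_iff_precompact_and_unique`: crux ⟺ tightness ∧ uniqueness of the cluster point**, and
  `crux_iff_orbitPrecompact_and_unique`: **crux ⟺ `MonotoneRG.OrbitPrecompact` (item 5955) ∧ uniqueness**
  (`pinnedPrecompact_of_orbitPrecompact`: any-`ρ` precompactness with non-degenerate cluster points pins
  down; `orbitPrecompact_of_pinnedLimit`). So every existence mechanism splits into a compactness half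
  (Gaussian domination + two-point regularity; cf. sibling `LocalBoundsDoubling`: it CONTAINS axis
  doubling of `⟨σ₀σ_x⟩`) and a uniqueness half (the dynamical content: markov-zoom-rigidity K1/K3,
  MonotoneRG's convergence criterion) — the latter is exactly where §E's `W_ε` lives (tight, two
  cluster points). `axisRatio_bounded_of_pinnedPrecompact` (§K): TIGHTNESS ALONE already forces axis
  doubling `⟨σ₀σ_{⌊sm⌋e₀}⟩/⟨σ₀σ_{me₀}⟩ ≤ B_s` (open on `ℤ³`): the compactness half is not free either.
* §I (NEW, the sharpest structural form) **`Dyadic.crux_iff_dyadic`: crux ⟺ the DYADIC pinned zoom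
  (meshes `2^{-k}` only) converges, for every `n`, locally uniformly off the diagonals, to a limit that
  is scale covariant on non-coincident configurations.** `Dyadic.pinnedLimit_of_dyadic` is the
  converse engine (exact identity `pz n (δ/s) x = pz₂(δ)(0,se₀)^{-n/2} pz n δ (s·x)`, uniform control
  on the compact set of dilates and on the axis arc, Heine–Cantor for the re-pinning `t ↦ t^{-n/2}`);
  `Dyadic.dyadicLimit_two_selfConsistent`: covariance under the dilation `2` is AUTOMATIC for any
  dyadic limit, so the load-bearing content is covariance under NON-dyadic dilations — exactly what
  §E's `W_ε` lacks (dyadic limit exists, `3`-covariant for no exponent). A proof of the crux may thus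
  establish convergence along ONE geometric mesh sequence (an RG-type iteration `T₂`) plus one
  non-dyadic covariance of the limit.
* §J (NEW) **TWO PRIMES FIX THE SCALE — `Dyadic.crux_iff_dyadic_continuous_triadic`: crux ⟺ ∃ S,
  [the pinned zoom converges along `2^{-k}` to `S`, all `n`, locally uniformly off the diagonals] ∧
  [`S n` continuous on `NonCoincident`] ∧ [ONE identity: `S n x = S₂(0,3e₀)^{-n/2} S n (3·x)`].**
  Engine `Dyadic.scaleCovariant_of_two_three`: `2`- and `3`-self-consistency + continuity ⇒ exact
  scale covariance for ALL `c > 0` (good scales form a closed subgroup of `ℝ₊ˣ` containing `2, 3`;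
  `{2^a3^b}` is dense — `two_zpow_eq_three_zpow`, `dense_closure_log_two_log_three`; a continuous
  multiplicative `Ψ` is a power — `map_real_smul`); `dyadicLimit_two_cfg0_two_pos`: dyadic convergence
  alone forces `S₂(0,2e₀)·S₂(0,e₀/2) = 1`, i.e. axis doubling bounded below. This is the exact formal
  content of the unread card `two-primes-fix-the-scale` / `CoprimeUpgrade`: NOT vacuous as a crux
  reformulation — what remains is dyadic existence (+ continuity of that limit) and one triadic identity.
* §G Open (informal): does full-filter convergence at `n = 2` plus convergence of all orders along ONE
  mesh sequence imply the crux? Is the two-point-only crux strictly weaker? (No inequality in the tree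
  controls `S_{2m}` convergence by `S₂` convergence; Gaussian domination only gives compactness.)

Provenance. Cycle 1 (v1–v3, 2026-08-15, ~1380 lines: `iff_core`, `iff_canonicalRho`, §F/§G/§H, nine
refuted strengthenings) is item evidence `run/gate/evidence/stmt-CriticalPhenomena-1981/2026081
5T223858Z-Disproof.lean`; that store is not mounted on the compute-free hub and the file was never
`crux write`-n, so cycle 2 RE-ESTABLISHES its load-bearing core from theorems landed in the tree since
(sibling crux 1344 `Theorems/MoebiusLimitExists/Negative/*`, Literature leaf files
`PointwiseScalingLimit{Scale,ScaleCovariant,EtaExists}`) instead of re-proving, and extends it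
(§B, §C `3/4`, §D pinned/four-point, §E). Superseded cycle-1 item: `isTranslationInvariant_of_continuousOn`
(translation invariance needs NO continuity: `FreeTranslations.limit_translate`).
-/

noncomputable section

namespace Summit.CriticalPhenomena.Ising3DConformalLimit.Cruxes.ExistsScaleCovariantLimit.Disproof

open Literature.Probability.LatticeModels Filter Set
open scoped Topology Real
open Summit.CriticalPhenomena.Ising3DConformalLimit.Theses
open Summit.CriticalPhenomena.Ising3DConformalLimit.MoebiusLimitExistsNegative
open Summit.CriticalPhenomena.Ising3DConformalLimit.MoebiusLimitExistsOnlyInteraction (rhoPin IsClusterPoint)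
open Summit.CriticalPhenomena.Ising3DConformalLimit.PinnedClusterPoints
open Summit.CriticalPhenomena.Ising3DConformalLimit.OnlyInteractionTightness
  (limit_isBoundedUnder tendstoLocallyUniformlyOn_comp_tendsto abs_rescaledCorrelator_le)
open Classical

/-! ## §A  The crux is PURE EXISTENCE: every other clause is free -/

/-- The clauses of the crux on a triple `(ρ, Δ, S)` (verbatim body of
`HyperoctahedralRP.ExistsScaleCovariantLimit`, named for re-use in the load-bearing analysis). [folklore] -/
def Clauses (ρ : ℝ → ℝ) (Δ : ℝ) (S : CorrFamily 3) : Prop :=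
  (∀ δ ∈ Set.Ioc (0:ℝ) 1, 0 < ρ δ) ∧ 0 < Δ ∧ HasPointwiseScalingLimit (criticalCorr 3) ρ S ∧
    (∀ n z, z ∉ NonCoincident 3 n → S n z = 0) ∧ IsNondegenerateTwoPoint S ∧
      IsTranslationInvariant S ∧ IsScaleCovariant Δ S

/-- The crux is `∃ ρ Δ S, Clauses ρ Δ S` (definitional). [folklore] -/
theorem crux_iff_clauses :
    HyperoctahedralRP.ExistsScaleCovariantLimit ↔ ∃ (ρ : ℝ → ℝ) (Δ : ℝ) (S : CorrFamily 3), Clauses ρ Δ S :=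
  Iff.rfl

/-- **crux ⟺ a non-degenerate full-filter pointwise limit exists** (`ρ > 0` kept): the clauses
`0 < Δ`, normalisation, `IsTranslationInvariant`, `IsScaleCovariant Δ` are ALL consequences of
existence + non-degeneracy — translations by `FreeTranslations.isTranslationInvariant_normalised_of_limit`
(no continuity needed: meshes `t/(k+1)`), dilations and the window `Δ ∈ [1/2,1]` by
`ScaleRedundant.exists_scaleCovariant_normalised` (Messager–Miracle-Solé + Cauchy equation + the
infrared / Simon–Lieb bounds). [folklore] -/
theorem iff_limit_nondeg :
    HyperoctahedralRP.ExistsScaleCovariantLimit ↔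
      ∃ (ρ : ℝ → ℝ) (S : CorrFamily 3), (∀ δ ∈ Set.Ioc (0:ℝ) 1, 0 < ρ δ) ∧
        HasPointwiseScalingLimit (criticalCorr 3) ρ S ∧ IsNondegenerateTwoPoint S := by
  constructor
  · rintro ⟨ρ, Δ, S, hρ, -, hlim, -, hnd, -, -⟩
    exact ⟨ρ, S, hρ, hlim, hnd⟩
  · rintro ⟨ρ, S, hρ, hlim, hnd⟩
    obtain ⟨Δ, hwin, hsc⟩ := exists_scaleCovariant_normalised hρ hlim hnd
    exact ⟨ρ, Δ, fun n x => if x ∈ NonCoincident 3 n then S n x else 0, hρ, by linarith [hwin.1],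
      normalised_hasLimit hlim, fun n z hz => if_neg hz, normalised_nondeg hnd,
      isTranslationInvariant_normalised_of_limit hlim, hsc⟩

/-- A renormalisation whose rescaled pair correlator converges to a positive value is eventually
non-zero along `δ → 0⁺`. [folklore] -/
theorem eventually_rho_ne_zero {ρ : ℝ → ℝ} {S : CorrFamily 3}
    (hlim : HasPointwiseScalingLimit (criticalCorr 3) ρ S) {x : Fin 2 → EuclideanSpace ℝ (Fin 3)}
    (hx : x ∈ NonCoincident 3 2) (hpos : 0 < S 2 x) : ∀ᶠ δ in 𝓝[>] (0:ℝ), ρ δ ≠ 0 := by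
  filter_upwards [((hlim 2).tendsto_at hx).eventually_const_lt hpos] with δ hδ h0
  rw [rescaledCorrelator_apply, h0] at hδ
  simp at hδ

/-- **crux ⟺ SOME full-filter pointwise scaling limit of the critical correlators has `S₂ ≢ 0` on
non-coincident pairs** — no positivity of `ρ`, no `Δ`, no normalisation, no symmetry, no
non-degeneracy beyond ONE pair: `ρ` can be made positive because odd critical correlators vanish
(`criticalCorr_eq_zero_of_odd`, `exists_pos_renormalisation`), and positivity at one pair propagates
to all pairs (`TwoPointPositivity.isNondegenerateTwoPoint_iff_exists_pos`; `S₂ ≥ 0` by Griffiths).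
This is the sharpest core: the crux is EXACTLY the open existence problem (Duminil-Copin, ICM 2022,
§8.4) and nothing else. [cite: DuminilCopinICM2022, §8.4 p. 29] -/
theorem iff_pure_existence :
    HyperoctahedralRP.ExistsScaleCovariantLimit ↔
      ∃ (ρ : ℝ → ℝ) (S : CorrFamily 3), HasPointwiseScalingLimit (criticalCorr 3) ρ S ∧
        ∃ x ∈ NonCoincident 3 2, S 2 x ≠ 0 := by
  rw [iff_limit_nondeg]
  constructor
  · rintro ⟨ρ, S, -, hlim, hnd⟩
    exact ⟨ρ, S, hlim, _, zero_unitVec_mem_nonCoincident one_ne_zero,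
      (hnd _ (zero_unitVec_mem_nonCoincident one_ne_zero)).ne'⟩
  · rintro ⟨ρ, S, hlim, x, hx, hne⟩
    have hpos : 0 < S 2 x := lt_of_le_of_ne (limit_two_nonneg hlim hx) (Ne.symm hne)
    have hnd : IsNondegenerateTwoPoint S :=
      (isNondegenerateTwoPoint_iff_exists_pos hlim).2 ⟨x, hx, hpos⟩
    obtain ⟨ρ', hρ', hlim'⟩ := hlim.exists_pos_renormalisation
      (fun n hn y => criticalCorr_eq_zero_of_odd (by norm_num) hn y) (eventually_rho_ne_zero hlim hx hpos)
    exact ⟨ρ', S, fun δ _ => hρ' δ, hlim', hnd⟩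

/-- **What a disproof must show**: EVERY full-filter pointwise scaling limit of the critical `ℤ³`
correlators (any renormalisation whatsoever) has identically vanishing two-point function on
non-coincident pairs. [folklore] -/
theorem not_crux_iff :
    ¬ HyperoctahedralRP.ExistsScaleCovariantLimit ↔
      ∀ (ρ : ℝ → ℝ) (S : CorrFamily 3), HasPointwiseScalingLimit (criticalCorr 3) ρ S →
        ∀ x ∈ NonCoincident 3 2, S 2 x = 0 := by
  rw [iff_pure_existence]
  push Not
  exact Iff.rfl

/-- Any witness is automatically continuous off the diagonals (mesh continuity,
`MeshContinuity.continuousOn_limit`), so the informal clause "locally uniformly … to a CONTINUOUS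
`S`" would also be free. [folklore] -/
theorem continuousOn_of_clauses {ρ : ℝ → ℝ} {Δ : ℝ} {S : CorrFamily 3} (h : Clauses ρ Δ S) (n : ℕ) :
    ContinuousOn (S n) (NonCoincident 3 n) :=
  Summit.CriticalPhenomena.Ising3DConformalLimit.LimitMeshContinuity.continuousOn_limit h.2.2.1 n

/-! ## §B  Position of the crux among the sibling statements -/

/-- Shared item: the decl is literally the same `Prop` in route `PlanarCornerRotations`. [folklore] -/
theorem shared_PlanarCornerRotations :
    HyperoctahedralRP.ExistsScaleCovariantLimit ↔ PlanarCornerRotations.ExistsScaleCovariantLimit :=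
  Iff.rfl

/-- … in route `PositivityBegetsConformality`. [folklore] -/
theorem shared_PositivityBegetsConformality :
    HyperoctahedralRP.ExistsScaleCovariantLimit ↔ PositivityBegetsConformality.ExistsScaleCovariantLimit :=
  Iff.rfl

/-- … in route `ConformalPoissonDevice`. [folklore] -/
theorem shared_ConformalPoissonDevice :
    HyperoctahedralRP.ExistsScaleCovariantLimit ↔ ConformalPoissonDevice.ExistsScaleCovariantLimit :=
  Iff.rfl

/-- crit-ising.S03 (`CritIsing3DEuclideanLimit`, item 0638) implies the crux. [folklore] -/
theorem of_euclideanLimit (h : CritIsing3DEuclideanLimit) : HyperoctahedralRP.ExistsScaleCovariantLimit := by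
  obtain ⟨ρ, Δ, S, hρ, -, hlim, hnd, -, -⟩ := h
  exact iff_limit_nondeg.2 ⟨ρ, S, hρ, hlim, hnd⟩

/-- The sibling crux `MoebiusLimit` (item stmt-CriticalPhenomena-1344) implies the crux. [folklore] -/
theorem of_moebiusLimit (h : EnergyNotSigmaSquared.MoebiusLimit) :
    HyperoctahedralRP.ExistsScaleCovariantLimit := by
  obtain ⟨ρ, Δ, S, hρ, -, hlim, hnd, -⟩ := h
  exact iff_limit_nondeg.2 ⟨ρ, S, hρ, hlim, hnd⟩

/-- The conjunct itself implies the crux (so refuting the crux refutes `Ising3DConformalLimit` and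
every route of the sub-problem alike). [folklore] -/
theorem of_conjunct (h : _root_.Ising3DConformalLimit) : HyperoctahedralRP.ExistsScaleCovariantLimit := by
  obtain ⟨ρ, Δ, S, hρ, -, hlim, hnd, -, -⟩ := h
  exact iff_limit_nondeg.2 ⟨ρ, S, hρ, hlim, hnd⟩

/-- **The rotation upgrade** — what the route must add to the crux: every non-degenerate pointwise
limit of the critical correlators is, after normalisation, `O(3)` invariant. [folklore] -/
def RotationUpgrade : Prop :=
  ∀ (ρ : ℝ → ℝ) (S : CorrFamily 3), (∀ δ ∈ Set.Ioc (0:ℝ) 1, 0 < ρ δ) →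
    HasPointwiseScalingLimit (criticalCorr 3) ρ S → IsNondegenerateTwoPoint S →
      IsRotationInvariant (fun n x => if x ∈ NonCoincident 3 n then S n x else 0)

/-- **Some limit is `O(3)` invariant ⟹ every limit is**: crit-ising.S03 implies the rotation upgrade
(uniqueness of pointwise limits up to one scale, `exists_scale_of_isNondegenerateTwoPoint`). [folklore] -/
theorem rotationUpgrade_of_euclideanLimit (h : CritIsing3DEuclideanLimit) : RotationUpgrade := by
  obtain ⟨ρ₀, Δ₀, S₀, hρ₀, -, hlim₀, hnd₀, hE₀, -⟩ := h
  intro ρ S hρ hlim hnd n R x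
  obtain ⟨c, -, hscale⟩ :=
    hlim₀.exists_scale_of_isNondegenerateTwoPoint (by norm_num) hρ₀ hρ hlim hnd₀ hnd
  have hiff : (fun i => R (x i)) ∈ NonCoincident 3 n ↔ x ∈ NonCoincident 3 n := by
    rw [mem_nonCoincident, mem_nonCoincident]
    exact R.injective.of_comp_iff x
  by_cases hx : x ∈ NonCoincident 3 n
  · simp only [if_pos (hiff.2 hx), if_pos hx, hscale n _ (hiff.2 hx), hscale n x hx, hE₀.2 n R x]
  · simp only [if_neg (mt hiff.1 hx), if_neg hx]

/-- crux + rotation upgrade ⟹ crit-ising.S03. [folklore] -/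
theorem euclideanLimit_of_rotationUpgrade (h : HyperoctahedralRP.ExistsScaleCovariantLimit)
    (hR : RotationUpgrade) : CritIsing3DEuclideanLimit := by
  obtain ⟨ρ, S, hρ, hlim, hnd⟩ := iff_limit_nondeg.1 h
  obtain ⟨Δ, hwin, hsc⟩ := exists_scaleCovariant_normalised hρ hlim hnd
  exact ⟨ρ, Δ, _, hρ, by linarith [hwin.1], normalised_hasLimit hlim, normalised_nondeg hnd,
    ⟨isTranslationInvariant_normalised_of_limit hlim, hR ρ S hρ hlim hnd⟩, hsc⟩

/-- **crit-ising.S03 ⟺ crux ∧ rotation upgrade**: on top of this crux, the Euclidean-limit item 0638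
is EXACTLY the statement that limits are isotropic. [folklore] -/
theorem euclideanLimit_iff_crux_and_rotationUpgrade :
    CritIsing3DEuclideanLimit ↔ HyperoctahedralRP.ExistsScaleCovariantLimit ∧ RotationUpgrade :=
  ⟨fun h => ⟨of_euclideanLimit h, rotationUpgrade_of_euclideanLimit h⟩,
    fun h => euclideanLimit_of_rotationUpgrade h.1 h.2⟩

/-- **The route's r3 item is the rotation upgrade**: `LimitRotationInvariant` (item 1980) is
equivalent to `HRP2Rigidity → RotationUpgrade` — its extra hypotheses (normalisation, translation
invariance, scale covariance with some `Δ`) are free for limits. [folklore] -/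
theorem limitRotationInvariant_iff :
    HyperoctahedralRP.LimitRotationInvariant ↔ (HyperoctahedralRP.HRP2Rigidity → RotationUpgrade) := by
  constructor
  · intro hL hA ρ S hρ hlim hnd
    obtain ⟨Δ, -, hsc⟩ := exists_scaleCovariant_normalised hρ hlim hnd
    exact hL hA ρ Δ _ hρ (normalised_hasLimit hlim) (fun n z hz => if_neg hz) (normalised_nondeg hnd)
      (isTranslationInvariant_normalised_of_limit hlim) hsc
  · intro hRU hA ρ Δ S hρ hlim hnorm hnd _ _
    have hS : (fun n x => if x ∈ NonCoincident 3 n then S n x else 0) = S := by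
      funext n x
      by_cases hx : x ∈ NonCoincident 3 n
      · rw [if_pos hx]
      · rw [if_neg hx, hnorm n x hx]
    have h := hRU hA ρ S hρ hlim hnd
    rwa [hS] at h

/-! ## §C  `Δ` is not a parameter: unique, in `[1/2, 3/4]`, `= (1+η)/2` -/

/-- Two scale exponents of a non-degenerate family on non-coincident pairs coincide
(evaluate at `(0,e₀)`, scale `2`). [folklore] -/
theorem delta_eq_of_two_scale_laws {S : CorrFamily 3} {Δ Δ' : ℝ} (hnd : IsNondegenerateTwoPoint S)
    (h : ∀ c : ℝ, 0 < c → ∀ x ∈ NonCoincident 3 2,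
      S 2 (fun i => c • x i) = c ^ (-(2:ℝ) * Δ) * S 2 x)
    (h' : ∀ c : ℝ, 0 < c → ∀ x ∈ NonCoincident 3 2,
      S 2 (fun i => c • x i) = c ^ (-(2:ℝ) * Δ') * S 2 x) : Δ = Δ' := by
  have hx := zero_unitVec_mem_nonCoincident (t := (1:ℝ)) one_ne_zero
  have ha := hnd _ hx
  have e₁ := h 2 two_pos _ hx
  have e₂ := h' 2 two_pos _ hx
  rw [e₁] at e₂
  have h2 := mul_right_cancel₀ ha.ne' e₂
  have hlog := congrArg Real.log h2
  rw [Real.log_rpow two_pos, Real.log_rpow two_pos] at hlog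
  have hl : 0 < Real.log 2 := Real.log_pos one_lt_two
  have h3 := mul_right_cancel₀ hl.ne' hlog
  linarith

/-- **Every witness has `Δ ∈ [1/2, 3/4]`** (no rotation hypothesis): infrared bound + Simon–Lieb
give `[1/2,1]`, and since a full-filter limit forces `η` to exist, Duminil-Copin–Panis 2025 Thm 1.5
(`η ≤ 1/2`) cuts the window to `3/4` (tree `exists_rpow_scale_mem_Icc_threeQuarters`).
[cite: DuminilCopinPanis2025LowerBounds, Theorem 1.5] -/
theorem delta_mem_Icc_of_clauses {ρ : ℝ → ℝ} {Δ : ℝ} {S : CorrFamily 3}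
    (hρ : ∀ δ ∈ Set.Ioc (0:ℝ) 1, 0 < ρ δ) (hlim : HasPointwiseScalingLimit (criticalCorr 3) ρ S)
    (hnd : IsNondegenerateTwoPoint S) (hsc : IsScaleCovariant Δ S) : Δ ∈ Set.Icc (1/2 : ℝ) (3/4) := by
  obtain ⟨Δ', hΔ', hcov, -, -⟩ := hlim.exists_rpow_scale_mem_Icc_threeQuarters hρ hnd
  have hΔ : Δ = Δ' := delta_eq_of_two_scale_laws hnd
    (fun c hc x _ => by exact_mod_cast hsc 2 c hc x) (fun c hc x hx => by exact_mod_cast hcov 2 c hc x hx)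
  rw [hΔ]; exact hΔ'

/-- REFUTED STRENGTHENING (new in cycle 2; cycle 1 had `1 < Δ`): no witness has `3/4 < Δ`.
[cite: DuminilCopinPanis2025LowerBounds, Theorem 1.5] -/
theorem not_crux_with_delta_gt_threeQuarters :
    ¬ ∃ (ρ : ℝ → ℝ) (Δ : ℝ) (S : CorrFamily 3), Clauses ρ Δ S ∧ 3/4 < Δ := by
  rintro ⟨ρ, Δ, S, ⟨hρ, -, hlim, -, hnd, -, hsc⟩, hΔ⟩
  exact absurd (delta_mem_Icc_of_clauses hρ hlim hnd hsc).2 (not_le.2 hΔ)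

/-- REFUTED STRENGTHENING: no witness has `Δ < 1/2` (Simon–Lieb). [cite: Simon1980, Thm. 1] -/
theorem not_crux_with_delta_lt_half :
    ¬ ∃ (ρ : ℝ → ℝ) (Δ : ℝ) (S : CorrFamily 3), Clauses ρ Δ S ∧ Δ < 1/2 := by
  rintro ⟨ρ, Δ, S, ⟨hρ, -, hlim, -, hnd, -, hsc⟩, hΔ⟩
  exact absurd (delta_mem_Icc_of_clauses hρ hlim hnd hsc).1 (not_le.2 hΔ)

/-- REFUTED STRENGTHENING: the planar value `Δ = 1/8` (Chelkak–Hongler–Izyurov) is impossible on `ℤ³`.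
[cite: ChelkakHonglerIzyurov2015, Thm 1.1] -/
theorem not_crux_with_planar_delta :
    ¬ ∃ (ρ : ℝ → ℝ) (S : CorrFamily 3), Clauses ρ (1/8) S := by
  rintro ⟨ρ, S, hρ, -, hlim, -, hnd, -, hsc⟩
  have h := (delta_mem_Icc_of_clauses hρ hlim hnd hsc).1
  norm_num at h

/-- **`Δ` is unique across ALL witnesses** (different `ρ`, different `S`): two non-degenerate limits
differ by `cⁿ` (`exists_scale_of_isNondegenerateTwoPoint`), so they have the same scale exponent.
Hence the `∃ Δ` of the crux is an `∃! Δ`. [folklore] -/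
theorem delta_unique {ρ ρ' : ℝ → ℝ} {Δ Δ' : ℝ} {S S' : CorrFamily 3}
    (h : Clauses ρ Δ S) (h' : Clauses ρ' Δ' S') : Δ = Δ' := by
  obtain ⟨hρ, -, hlim, -, hnd, -, hsc⟩ := h
  obtain ⟨hρ', -, hlim', -, hnd', -, hsc'⟩ := h'
  obtain ⟨c, hc, hscale⟩ := hlim.exists_scale_of_isNondegenerateTwoPoint (by norm_num) hρ hρ' hlim' hnd hnd'
  refine delta_eq_of_two_scale_laws hnd (fun a ha x _ => by exact_mod_cast hsc 2 a ha x) ?_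
  intro a ha x hx
  have hax : (fun i => a • x i) ∈ NonCoincident 3 2 := (smul_mem_nonCoincident_iff ha.ne' x).2 hx
  have e1 := hscale 2 _ hax
  have e2 := hscale 2 x hx
  have e3 : S' 2 (fun i => a • x i) = a ^ (-(2:ℝ) * Δ') * S' 2 x := by exact_mod_cast hsc' 2 a ha x
  have hc2 : c ^ 2 ≠ 0 := pow_ne_zero 2 hc.ne'
  rw [e1, e2] at e3
  -- `c² S₂(a x) = a^{-2Δ'} c² S₂ x`
  have : S 2 (fun i => a • x i) = a ^ (-(2:ℝ) * Δ') * S 2 x := by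
    have e4 : c ^ 2 * S 2 (fun i => a • x i) = c ^ 2 * (a ^ (-(2:ℝ) * Δ') * S 2 x) := by
      rw [e3]; ring
    exact mul_left_cancel₀ hc2 e4
  exact this

/-- The crux with `∃! Δ`. [folklore] -/
theorem crux_iff_existsUnique_delta :
    HyperoctahedralRP.ExistsScaleCovariantLimit ↔
      ∃! Δ : ℝ, ∃ (ρ : ℝ → ℝ) (S : CorrFamily 3), Clauses ρ Δ S := by
  constructor
  · rintro ⟨ρ, Δ, S, h⟩
    exact ⟨Δ, ⟨ρ, S, h⟩, fun Δ' ⟨ρ', S', h'⟩ => delta_unique h' h⟩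
  · rintro ⟨Δ, ⟨ρ, S, h⟩, -⟩
    exact ⟨ρ, Δ, S, h⟩

/-- **The crux forces `η` to exist**, `η ∈ [0, 1/2]` (a LATTICE statement, free of `ρ`, `Δ`, `S`):
`log ⟨σ₀σ_y⟩_{β_c} / log ‖y‖ → −(1+η)`. A proof that `η` does not exist (e.g. an oscillating effective
exponent) refutes the crux. [cite: DuminilCopinPanis2025LowerBounds, Theorem 1.5] -/
theorem crux_implies_eta_exists (h : HyperoctahedralRP.ExistsScaleCovariantLimit) :
    ∃ η ∈ Set.Icc (0:ℝ) (1/2), HasIsingExponentEta 3 η := by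
  obtain ⟨ρ, S, hρ, hlim, hnd⟩ := iff_limit_nondeg.1 h
  exact hlim.exists_isingEta hρ hnd

/-- **`Δ = (1 + η)/2`** for every witness. [cite: FrancescoMathieuSenechal1997, §4.3.1 eq. (4.56)] -/
theorem delta_eq_of_eta {ρ : ℝ → ℝ} {Δ η : ℝ} {S : CorrFamily 3} (h : Clauses ρ Δ S)
    (hη : HasIsingExponentEta 3 η) : Δ = (1 + η) / 2 := by
  obtain ⟨hρ, -, hlim, -, hnd, -, hsc⟩ := h
  obtain ⟨Δ', -, hcov, -, hη'⟩ := hlim.exists_rpow_scale_mem_Icc_threeQuarters hρ hnd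
  have hΔ : Δ = Δ' := delta_eq_of_two_scale_laws hnd
    (fun c hc x _ => by exact_mod_cast hsc 2 c hc x) (fun c hc x hx => by exact_mod_cast hcov 2 c hc x hx)
  have := HasIsingExponentEta.unique hη' hη
  rw [hΔ]; linarith

/-! ## §D  `ρ`-free and `S`-free forms: the pinned zoom; lattice refutation criteria -/

/-- Abbreviation: the reference pair `(0, e₀)`. [folklore] -/
abbrev cfg01 : Fin 2 → EuclideanSpace ℝ (Fin 3) := ![0, EuclideanSpace.single 0 1]

/-- **The pinned zoom converges along the FULL filter under any witness**: with
`ρ_pin(δ) = ⟨σ₀σ_{⌊1/δ⌋e₀}⟩_{β_c}^{-1/2}` (`rhoPin`), `HasPointwiseScalingLimit (criticalCorr 3) ρ_pin (aⁿ S'ₙ)`,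
`a = S'₂(0,e₀)^{-1/2}` (exact factorisation `ρ_pin = r(δ)^{-1/2} ρ`, `PinnedClusterPoints.rescaled_pin_eq`,
and Mathlib's `TendstoLocallyUniformlyOn.mul₀_of_isBoundedUnder`; the sibling file
`OnlyInteractionTightness` has the same along mesh SEQUENCES). [folklore] -/
theorem hasPointwiseScalingLimit_rhoPin {ρ : ℝ → ℝ} {S' : CorrFamily 3}
    (hρ : ∀ δ ∈ Set.Ioc (0:ℝ) 1, 0 < ρ δ)
    (hlim : HasPointwiseScalingLimit (criticalCorr 3) ρ S') (hnd : IsNondegenerateTwoPoint S') :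
    HasPointwiseScalingLimit (criticalCorr 3) rhoPin
      (fun n x => ((S' 2 cfg01) ^ (-(1 / 2 : ℝ))) ^ n * S' n x) := by
  intro n
  have hA : 0 < S' 2 cfg01 := hnd _ cfg01_mem
  set r : ℝ → ℝ := fun δ => (rescaledCorrelator (criticalCorr 3) ρ 2 δ cfg01) ^ (-(1 / 2 : ℝ)) with hr
  have hr_t : Tendsto (fun δ => r δ ^ n) (𝓝[>] (0:ℝ)) (𝓝 (((S' 2 cfg01) ^ (-(1 / 2 : ℝ))) ^ n)) := by
    have h2 : Tendsto (fun δ => rescaledCorrelator (criticalCorr 3) ρ 2 δ cfg01) (𝓝[>] (0:ℝ))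
        (𝓝 (S' 2 cfg01)) := (hlim 2).tendsto_at cfg01_mem
    exact (h2.rpow_const (p := -(1 / 2 : ℝ)) (Or.inl hA.ne')).pow n
  have hF1 : TendstoLocallyUniformlyOn (fun δ (_ : Fin n → EuclideanSpace ℝ (Fin 3)) => r δ ^ n)
      (fun _ => ((S' 2 cfg01) ^ (-(1 / 2 : ℝ))) ^ n) (𝓝[>] (0:ℝ)) (NonCoincident 3 n) :=
    (hr_t.tendstoUniformlyOn_const (NonCoincident 3 n)).tendstoLocallyUniformlyOn
  have hprod := hF1.mul₀_of_isBoundedUnder (hlim n)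
    (fun x _ => isBoundedUnder_of ⟨dist (((S' 2 cfg01) ^ (-(1 / 2 : ℝ))) ^ n) 0, fun _ => le_rfl⟩)
    (fun x hx => limit_isBoundedUnder hlim n hx)
  refine hprod.congr_inseparable ?_
  filter_upwards [Ioc_mem_nhdsGT one_pos] with δ hδ x _
  exact Inseparable.of_eq (rescaled_pin_eq (hρ δ hδ) n x).symm

/-- `ρ_pin > 0` everywhere. [folklore] -/
theorem rhoPin_pos (δ : ℝ) : 0 < rhoPin δ :=
  Real.rpow_pos_of_pos (criticalTwoPoint_pos3 _) _

/-- A pinned limit has `S₂(0,e₀) = 1`. [folklore] -/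
theorem pinned_cfg01 {S : CorrFamily 3} (hlim : HasPointwiseScalingLimit (criticalCorr 3) rhoPin S) :
    S 2 cfg01 = 1 := by
  have h := (hlim 2).tendsto_at cfg01_mem
  simp_rw [rescaled_pin_cfg01] at h
  exact (tendsto_nhds_unique tendsto_const_nhds h).symm

/-- **crux ⟺ THE PINNED ZOOM CONVERGES** (full filter, every `n`, locally uniformly off the
diagonals) — the `ρ`-free, `Δ`-free, symmetry-free form of the crux: every unknown constant is gone,
non-degeneracy is automatic (`S₂(0,e₀) = 1`). This is the statement a prover must establish and a
disprover must kill. [folklore] -/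
theorem iff_pinned :
    HyperoctahedralRP.ExistsScaleCovariantLimit ↔
      ∃ S : CorrFamily 3, HasPointwiseScalingLimit (criticalCorr 3) rhoPin S := by
  constructor
  · intro h
    obtain ⟨ρ, S', hρ, hlim, hnd⟩ := iff_limit_nondeg.1 h
    exact ⟨_, hasPointwiseScalingLimit_rhoPin hρ hlim hnd⟩
  · rintro ⟨S, hlim⟩
    refine iff_pure_existence.2 ⟨rhoPin, S, hlim, _, cfg01_mem, ?_⟩
    rw [pinned_cfg01 hlim]
    exact one_ne_zero

/-- **Lattice refutation criterion 1 (axis regular variation)**, `ρ`-free and `S`-free: under the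
crux there is `Δ ∈ [1/2, 3/4]` with `⟨σ₀σ_{⌊s m⌋e₀}⟩_{β_c} / ⟨σ₀σ_{m e₀}⟩_{β_c} → s^{-2Δ}` as the
integer `m → ∞`, for every real `s > 0` — the axis two-point SEQUENCE is regularly varying. Any
log-periodic modulation of `⟨σ₀σ_{m e₀}⟩` (discrete scale invariance) refutes the crux. (Cycle 1, §F,
re-derived from the pinned form.) [cite: DuminilCopinICM2022, §8.4 p. 29] -/
theorem axis_ratio_tendsto (h : HyperoctahedralRP.ExistsScaleCovariantLimit) :
    ∃ Δ ∈ Set.Icc (1/2:ℝ) (3/4), ∀ s : ℝ, 0 < s →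
      Tendsto (fun k : ℕ => criticalTwoPoint 3 (Pi.single 0 ⌊s * ((k:ℝ) + 1)⌋) /
        criticalTwoPoint 3 (Pi.single 0 (((k + 1 : ℕ) : ℤ)))) atTop (𝓝 (s ^ (-(2:ℝ) * Δ))) := by
  obtain ⟨S, hlim⟩ := iff_pinned.1 h
  have hρ : ∀ δ ∈ Set.Ioc (0:ℝ) 1, 0 < rhoPin δ := fun δ _ => rhoPin_pos δ
  have h1 : S 2 cfg01 = 1 := pinned_cfg01 hlim
  have hnd : IsNondegenerateTwoPoint S :=
    (isNondegenerateTwoPoint_iff_exists_pos hlim).2 ⟨_, cfg01_mem, by rw [h1]; exact one_pos⟩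
  obtain ⟨Δ, hΔ, hcov, -, -⟩ := hlim.exists_rpow_scale_mem_Icc_threeQuarters hρ hnd
  refine ⟨Δ, hΔ, fun s hs => ?_⟩
  have hval : S 2 (![0, EuclideanSpace.single 0 s] : Fin 2 → EuclideanSpace ℝ (Fin 3)) =
      s ^ (-(2:ℝ) * Δ) := by
    have hc := hcov 2 s hs _ cfg01_mem
    rw [h1, mul_one] at hc
    have hcfg : (fun i => s • (cfg01 i)) = (![0, EuclideanSpace.single 0 s] : Fin 2 → EuclideanSpace ℝ (Fin 3)) := by
      funext i
      fin_cases i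
      · simp
      · simp only [Matrix.cons_val_one, Matrix.cons_val_fin_one, Fin.mk_one]
        ext j
        by_cases hj : j = 0
        · subst hj; simp
        · simp [hj]
    rw [hcfg] at hc
    exact_mod_cast hc
  have ht := ((hlim 2).tendsto_at (zero_unitVec_mem_nonCoincident hs.ne')).comp
    (tendsto_div_succ_nhdsGT one_pos)
  rw [hval] at ht
  refine ht.congr fun k => ?_
  simp only [Function.comp_apply, rescaled_pin_cfg0s]
  have hk : (0:ℝ) < (k:ℝ) + 1 := by positivity
  have e1 : s / (1 / ((k:ℝ) + 1)) = s * ((k:ℝ) + 1) := by field_simp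
  have e2 : (1:ℝ) / (1 / ((k:ℝ) + 1)) = ((k + 1 : ℕ) : ℝ) := by push_cast; field_simp
  rw [e1, e2, Int.floor_natCast]

/-- The scale-free four-point ratio of a family: `Q(x) = S₄(x) / (S₂(x₀,x₁) S₂(x₂,x₃))`. [folklore] -/
def fourRatio (S : CorrFamily 3) (x : Fin 4 → EuclideanSpace ℝ (Fin 3)) : ℝ :=
  S 4 x / (S 2 ![x 0, x 1] * S 2 ![x 2, x 3])

/-- **Lattice refutation criterion 2 (a renormalisation-free four-point observable converges)**:
under a witness, the RAW lattice ratio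
`⟨σ_{[x₀/δ]}σ_{[x₁/δ]}σ_{[x₂/δ]}σ_{[x₃/δ]}⟩ / (⟨σ_{[x₀/δ]}σ_{[x₁/δ]}⟩⟨σ_{[x₂/δ]}σ_{[x₃/δ]}⟩)` — no `ρ`,
no `Δ` — converges as `δ → 0⁺` for every non-coincident quadruple `x`, to `Q(x)`; a `δ`-drift of this
Monte-Carlo-accessible quantity at one fixed `x` refutes the crux. [folklore] -/
theorem fourPoint_ratio_tendsto {ρ : ℝ → ℝ} {Δ : ℝ} {S : CorrFamily 3} (h : Clauses ρ Δ S)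
    {x : Fin 4 → EuclideanSpace ℝ (Fin 3)} (hx : x ∈ NonCoincident 3 4) :
    Tendsto (fun δ => criticalCorr 3 4 (fun i => latticeApprox δ (x i)) /
      (criticalCorr 3 2 (fun i => latticeApprox δ ((![x 0, x 1] : Fin 2 → _) i)) *
        criticalCorr 3 2 (fun i => latticeApprox δ ((![x 2, x 3] : Fin 2 → _) i))))
      (𝓝[>] (0:ℝ)) (𝓝 (fourRatio S x)) := by
  obtain ⟨hρ, -, hlim, -, hnd, -, -⟩ := h
  have hinj : Function.Injective x := hx
  have h01 : (![x 0, x 1] : Fin 2 → EuclideanSpace ℝ (Fin 3)) ∈ NonCoincident 3 2 :=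
    pair_mem_nonCoincident (hinj.ne (by decide))
  have h23 : (![x 2, x 3] : Fin 2 → EuclideanSpace ℝ (Fin 3)) ∈ NonCoincident 3 2 :=
    pair_mem_nonCoincident (hinj.ne (by decide))
  have t4 := (hlim 4).tendsto_at hx
  have t01 := (hlim 2).tendsto_at h01
  have t23 := (hlim 2).tendsto_at h23
  have hpos : 0 < S 2 ![x 0, x 1] * S 2 ![x 2, x 3] := mul_pos (hnd _ h01) (hnd _ h23)
  have hq := t4.div (t01.mul t23) hpos.ne'
  refine hq.congr' ?_
  filter_upwards [Ioc_mem_nhdsGT one_pos] with δ hδ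
  have hρ0 : ρ δ ≠ 0 := (hρ δ hδ).ne'
  simp only [rescaledCorrelator_apply, Pi.div_apply]
  have e : ρ δ ^ 2 * criticalCorr 3 2 (fun i => latticeApprox δ ((![x 0, x 1] : Fin 2 → _) i)) *
      (ρ δ ^ 2 * criticalCorr 3 2 (fun i => latticeApprox δ ((![x 2, x 3] : Fin 2 → _) i))) =
      ρ δ ^ 4 * (criticalCorr 3 2 (fun i => latticeApprox δ ((![x 0, x 1] : Fin 2 → _) i)) *
        criticalCorr 3 2 (fun i => latticeApprox δ ((![x 2, x 3] : Fin 2 → _) i))) := by ring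
  rw [e, mul_div_mul_left _ _ (pow_ne_zero 4 hρ0)]

/-- `Q` is dilation INVARIANT (degree-`0` homogeneous) for a witness. [folklore] -/
theorem fourRatio_smul {ρ : ℝ → ℝ} {Δ : ℝ} {S : CorrFamily 3} (h : Clauses ρ Δ S)
    {c : ℝ} (hc : 0 < c) (x : Fin 4 → EuclideanSpace ℝ (Fin 3)) :
    fourRatio S (fun i => c • x i) = fourRatio S x := by
  obtain ⟨-, -, -, -, -, -, hsc⟩ := h
  unfold fourRatio
  have e4 := hsc 4 c hc x
  have e01 := hsc 2 c hc ![x 0, x 1]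
  have e23 := hsc 2 c hc ![x 2, x 3]
  have c01 : (fun i => c • (![x 0, x 1] : Fin 2 → EuclideanSpace ℝ (Fin 3)) i) = ![c • x 0, c • x 1] := by
    funext i; fin_cases i <;> rfl
  have c23 : (fun i => c • (![x 2, x 3] : Fin 2 → EuclideanSpace ℝ (Fin 3)) i) = ![c • x 2, c • x 3] := by
    funext i; fin_cases i <;> rfl
  rw [c01] at e01
  rw [c23] at e23
  rw [e4, e01, e23]
  have hpow : c ^ (-((4:ℕ):ℝ) * Δ) = c ^ (-((2:ℕ):ℝ) * Δ) * c ^ (-((2:ℕ):ℝ) * Δ) := by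
    rw [← Real.rpow_add hc]; congr 1; push_cast; ring
  rw [hpow]
  have hne : c ^ (-((2:ℕ):ℝ) * Δ) ≠ 0 := (Real.rpow_pos_of_pos hc _).ne'
  rw [show c ^ (-((2:ℕ):ℝ) * Δ) * S 2 ![x 0, x 1] * (c ^ (-((2:ℕ):ℝ) * Δ) * S 2 ![x 2, x 3]) =
      (c ^ (-((2:ℕ):ℝ) * Δ) * c ^ (-((2:ℕ):ℝ) * Δ)) * (S 2 ![x 0, x 1] * S 2 ![x 2, x 3]) by ring,
    mul_div_mul_left _ _ (mul_ne_zero hne hne)]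

/-- `Q` is translation invariant for a witness. [folklore] -/
theorem fourRatio_translate {ρ : ℝ → ℝ} {Δ : ℝ} {S : CorrFamily 3} (h : Clauses ρ Δ S)
    (v : EuclideanSpace ℝ (Fin 3)) (x : Fin 4 → EuclideanSpace ℝ (Fin 3)) :
    fourRatio S (fun i => x i + v) = fourRatio S x := by
  obtain ⟨-, -, -, -, -, htr, -⟩ := h
  unfold fourRatio
  have c01 : (fun i => (![x 0, x 1] : Fin 2 → EuclideanSpace ℝ (Fin 3)) i + v) = ![x 0 + v, x 1 + v] := by
    funext i; fin_cases i <;> rfl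
  have c23 : (fun i => (![x 2, x 3] : Fin 2 → EuclideanSpace ℝ (Fin 3)) i + v) = ![x 2 + v, x 3 + v] := by
    funext i; fin_cases i <;> rfl
  have e01 := htr 2 v ![x 0, x 1]
  have e23 := htr 2 v ![x 2, x 3]
  rw [c01] at e01
  rw [c23] at e23
  rw [htr 4 v x, e01, e23]


/-! ## §E  LOAD-BEARING ANALYSIS: the full filter against two-point axiomatics — a discretely
self-similar lattice family -/

/-- The log-periodic power profile `φ_ε(r) = r⁻¹ · exp(ε · sin(2π log₂ r))`. [folklore] -/
def dsiProfile (ε r : ℝ) : ℝ := r⁻¹ * Real.exp (ε * Real.sin (2 * π * Real.logb 2 r))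

/-- The witness two-point function on `ℤ³`: `1` at `0`, `φ_ε(‖z‖_∞)` otherwise. [folklore] -/
def dsiTwoPoint (ε : ℝ) (z : Site 3) : ℝ := if z = 0 then 1 else dsiProfile ε ‖z‖

/-- The witness lattice family `W_ε`: pair function `dsiTwoPoint ε (y₁ − y₀)`, `1` at order `0`,
`0` at every other order. [folklore] -/
def dsiFamily (ε : ℝ) : LatticeCorrFamily 3
  | 0, _ => 1
  | 2, y => dsiTwoPoint ε (y 1 - y 0)
  | _, _ => 0

/-! ### Elementary properties shared with `criticalCorr 3` -/

theorem dsiProfile_pos (ε : ℝ) {r : ℝ} (hr : 0 < r) : 0 < dsiProfile ε r :=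
  mul_pos (inv_pos.2 hr) (Real.exp_pos _)

theorem dsiTwoPoint_pos (ε : ℝ) (z : Site 3) : 0 < dsiTwoPoint ε z := by
  unfold dsiTwoPoint
  split_ifs with h
  · exact one_pos
  · exact dsiProfile_pos ε (norm_pos_iff.2 h)

theorem dsiTwoPoint_zero (ε : ℝ) : dsiTwoPoint ε 0 = 1 := by simp [dsiTwoPoint]

theorem dsiTwoPoint_neg (ε : ℝ) (z : Site 3) : dsiTwoPoint ε (-z) = dsiTwoPoint ε z := by
  unfold dsiTwoPoint
  simp only [neg_eq_zero, norm_neg]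

theorem dsiFamily_two (ε : ℝ) (y : Fin 2 → Site 3) : dsiFamily ε 2 y = dsiTwoPoint ε (y 1 - y 0) := rfl

theorem dsiFamily_zero (ε : ℝ) (y : Fin 0 → Site 3) : dsiFamily ε 0 y = 1 := rfl

/-- Lattice translation invariance (as `criticalCorr_translate`). [folklore] -/
theorem dsiFamily_translate (ε : ℝ) {n : ℕ} (y : Fin n → Site 3) (v : Site 3) :
    dsiFamily ε n (fun i => y i + v) = dsiFamily ε n y := by
  match n with
  | 0 => rfl
  | 1 => rfl
  | 2 =>
    show dsiTwoPoint ε ((y 1 + v) - (y 0 + v)) = dsiTwoPoint ε (y 1 - y 0)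
    congr 1; abel
  | _ + 3 => rfl

/-- Odd orders vanish (as `criticalCorr_eq_zero_of_odd`). [folklore] -/
theorem dsiFamily_odd (ε : ℝ) {n : ℕ} (hn : Odd n) (y : Fin n → Site 3) : dsiFamily ε n y = 0 := by
  match n, hn with
  | 0, hn => exact absurd hn (by decide)
  | 1, _ => rfl
  | 2, hn => exact absurd hn (by decide)
  | _ + 3, _ => rfl

/-- Symmetry of the pair function (as `criticalCorr_two_pair_comm`). [folklore] -/
theorem dsiFamily_two_comm (ε : ℝ) (a b : Site 3) : dsiFamily ε 2 ![a, b] = dsiFamily ε 2 ![b, a] := by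
  rw [dsiFamily_two, dsiFamily_two]
  simp only [Matrix.cons_val_one, Matrix.cons_val_fin_one, Matrix.cons_val_zero]
  rw [← dsiTwoPoint_neg, neg_sub]

/-- A non-zero lattice point has sup norm `≥ 1`. [folklore] -/
theorem one_le_norm_of_ne_zero {z : Site 3} (hz : z ≠ 0) : (1:ℝ) ≤ ‖z‖ := by
  have h := norm_pos_iff.2 hz
  rw [Site.norm_eq_supNorm] at h ⊢
  exact_mod_cast (Nat.one_le_iff_ne_zero.2 (by exact_mod_cast h.ne'))

/-- **The two rigorous power bounds, same shape as `criticalTwoPoint_bounds` at `d = 3`**: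
`c‖z‖^{-(3-1)} ≤ W ≤ C‖z‖^{-(3-2)}`. [folklore] -/
theorem dsiTwoPoint_bounds (ε : ℝ) : ∃ c C : ℝ, 0 < c ∧ ∀ z : Site 3, z ≠ 0 →
    c * (‖z‖ : ℝ) ^ (-((3 : ℝ) - 1)) ≤ dsiTwoPoint ε z ∧
      dsiTwoPoint ε z ≤ C * (‖z‖ : ℝ) ^ (-((3 : ℝ) - 2)) := by
  refine ⟨Real.exp (-|ε|), Real.exp |ε|, Real.exp_pos _, fun z hz => ?_⟩
  have h1 := one_le_norm_of_ne_zero hz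
  have hr : 0 < ‖z‖ := by linarith
  unfold dsiTwoPoint
  rw [if_neg hz]
  unfold dsiProfile
  have hsin : |ε * Real.sin (2 * π * Real.logb 2 ‖z‖)| ≤ |ε| := by
    rw [abs_mul]
    exact mul_le_of_le_one_right (abs_nonneg _) (Real.abs_sin_le_one _)
  have hlo : Real.exp (-|ε|) ≤ Real.exp (ε * Real.sin (2 * π * Real.logb 2 ‖z‖)) :=
    Real.exp_le_exp.2 (by linarith [neg_abs_le (ε * Real.sin (2 * π * Real.logb 2 ‖z‖))])
  have hhi : Real.exp (ε * Real.sin (2 * π * Real.logb 2 ‖z‖)) ≤ Real.exp |ε| :=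
    Real.exp_le_exp.2 (le_abs_self _ |>.trans hsin)
  have e2 : (‖z‖ : ℝ) ^ (-((3 : ℝ) - 1)) = (‖z‖ ^ 2)⁻¹ := by
    rw [show (-((3:ℝ) - 1)) = -(2:ℝ) by norm_num, Real.rpow_neg hr.le, Real.rpow_two]
  have e1 : (‖z‖ : ℝ) ^ (-((3 : ℝ) - 2)) = ‖z‖⁻¹ := by
    rw [show (-((3:ℝ) - 2)) = -(1:ℝ) by norm_num, Real.rpow_neg_one]
  rw [e2, e1]
  constructor
  · have hsq : (‖z‖ ^ 2)⁻¹ ≤ ‖z‖⁻¹ := by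
      rw [inv_le_inv₀ (by positivity) hr]
      nlinarith
    calc Real.exp (-|ε|) * (‖z‖ ^ 2)⁻¹ ≤ Real.exp (ε * Real.sin (2 * π * Real.logb 2 ‖z‖)) * ‖z‖⁻¹ :=
          mul_le_mul hlo hsq (by positivity) (Real.exp_pos _).le
      _ = _ := by ring
  · rw [mul_comm]
    exact mul_le_mul_of_nonneg_right hhi (inv_nonneg.2 hr.le)

/-- `|W| ≤ 1` for `|ε| ≤ 1/2` (as `|⟨∏σ⟩| ≤ 1`). [folklore] -/
theorem dsiTwoPoint_le_one {ε : ℝ} (hε : |ε| ≤ 1/2) (z : Site 3) : dsiTwoPoint ε z ≤ 1 := by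
  unfold dsiTwoPoint
  split_ifs with hz
  · exact le_rfl
  unfold dsiProfile
  have h1 := one_le_norm_of_ne_zero hz
  rcases h1.eq_or_lt with h | h
  · rw [← h]; simp
  · -- `‖z‖ ≥ 2` (an integer `> 1`), and `exp(1/2) < 2`
    have h2 : (2:ℝ) ≤ ‖z‖ := by
      rw [Site.norm_eq_supNorm] at h ⊢
      exact_mod_cast (show 2 ≤ Site.supNorm z by exact_mod_cast h)
    have hexp : Real.exp (ε * Real.sin (2 * π * Real.logb 2 ‖z‖)) ≤ Real.exp (1/2) := by
      refine Real.exp_le_exp.2 ?_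
      have : |ε * Real.sin (2 * π * Real.logb 2 ‖z‖)| ≤ 1/2 := by
        rw [abs_mul]
        exact (mul_le_of_le_one_right (abs_nonneg _) (Real.abs_sin_le_one _)).trans hε
      exact (le_abs_self _).trans this
    have hhalf : Real.exp (1/2 : ℝ) < 2 := by
      have hsq : Real.exp (1/2 : ℝ) ^ 2 = Real.exp 1 := by
        rw [sq, ← Real.exp_add]; norm_num
      nlinarith [Real.exp_one_lt_d9, Real.exp_pos (1/2 : ℝ), hsq]
    rw [inv_mul_le_iff₀ (by linarith)]
    linarith

/-! ### The decisive arithmetic: `sin(2π log₂ 3) ≠ 0` -/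

/-- `log₂ 9` is not an integer: `3 < log₂ 9 < 4`. [folklore] -/
theorem sin_two_pi_logb_three_ne_zero : Real.sin (2 * π * Real.logb 2 3) ≠ 0 := by
  intro h
  obtain ⟨n, hn⟩ := Real.sin_eq_zero_iff.1 h
  have hpi : π ≠ 0 := Real.pi_ne_zero
  have hn' : (n : ℝ) = 2 * Real.logb 2 3 := by
    have := hn
    field_simp at this
    linarith
  have h9 : 2 * Real.logb 2 3 = Real.logb 2 9 := by
    rw [show (9:ℝ) = 3 ^ 2 by norm_num, Real.logb_pow]
    push_cast; ring
  rw [h9] at hn'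
  have hlt : (3:ℝ) < Real.logb 2 9 := by
    rw [Real.lt_logb_iff_rpow_lt one_lt_two (by norm_num)]
    norm_num
  have hgt : Real.logb 2 9 < 4 := by
    rw [Real.logb_lt_iff_lt_rpow one_lt_two (by norm_num)]
    norm_num
  rw [← hn'] at hlt hgt
  have h3 : (3:ℤ) < n := by exact_mod_cast hlt
  have h4 : n < (4:ℤ) := by exact_mod_cast hgt
  omega

/-! ### Axis bookkeeping -/

theorem dsiTwoPoint_single_nat (ε : ℝ) {m : ℕ} (hm : 0 < m) :
    dsiTwoPoint ε (Pi.single 0 (m : ℤ)) = dsiProfile ε m := by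
  unfold dsiTwoPoint
  have hne : (Pi.single 0 (m : ℤ) : Site 3) ≠ 0 := by
    intro h
    have := congrFun h 0
    simp at this
    omega
  rw [if_neg hne, norm_single_axis]
  push_cast
  rw [abs_of_nonneg (by positivity)]

/-- A lattice family `G` "with the pair function `W_ε`": `G 2 (y₀, y₁) = W_ε(y₁ − y₀)`; its
higher orders are arbitrary (e.g. the Wick/Gaussian completion). [folklore] -/
def HasDsiPair (ε : ℝ) (G : LatticeCorrFamily 3) : Prop :=
  ∀ y : Fin 2 → Site 3, G 2 y = dsiTwoPoint ε (y 1 - y 0)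

theorem hasDsiPair_dsiFamily (ε : ℝ) : HasDsiPair ε (dsiFamily ε) := fun _ => rfl

/-- The rescaled pair correlator of such a `G` at the axis pair `(0, t e₀)`. [folklore] -/
theorem rescaled_dsi_axisPair {ε : ℝ} {G : LatticeCorrFamily 3} (hG : HasDsiPair ε G)
    (ρ : ℝ → ℝ) (δ t : ℝ) :
    rescaledCorrelator G ρ 2 δ
        ((![0, EuclideanSpace.single 0 t] : Fin 2 → EuclideanSpace ℝ (Fin 3))) =
      ρ δ ^ 2 * dsiTwoPoint ε (Pi.single (0 : Fin 3) ⌊t / δ⌋) := by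
  rw [rescaledCorrelator_apply, latticeApprox_comp_two, hG]
  simp only [Matrix.cons_val_zero, Matrix.cons_val_one, Matrix.cons_val_fin_one,
    latticeApprox_zero, sub_zero]
  congr 2
  funext i
  rw [latticeApprox_apply, PiLp.single_apply]
  by_cases hi : i = 0
  · subst hi; simp
  · rw [if_neg hi, Pi.single_eq_of_ne hi, zero_div, Int.floor_zero]

/-- `⌊a / (m⁻¹)⌋ = a·m` for naturals `a, m`. [folklore] -/
theorem floor_div_inv_nat (a m : ℕ) : ⌊(a : ℝ) / ((m : ℝ)⁻¹)⌋ = ((a * m : ℕ) : ℤ) := by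
  rw [div_inv_eq_mul, show (a : ℝ) * m = ((a * m : ℕ) : ℝ) by push_cast; ring, Int.floor_natCast]

/-- The ratio `φ_ε(3r)/φ_ε(r)` along `r = 2^j`: constant. [folklore] -/
theorem dsiProfile_ratio_pow (ε : ℝ) (j : ℕ) :
    dsiProfile ε ((3 * 2 ^ j : ℕ)) / dsiProfile ε ((2 ^ j : ℕ)) =
      3⁻¹ * Real.exp (ε * Real.sin (2 * π * Real.logb 2 3)) := by
  unfold dsiProfile
  have h2 : (0:ℝ) < 2 ^ j := by positivity
  have hl2 : Real.logb 2 ((2 ^ j : ℕ) : ℝ) = j := by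
    push_cast
    rw [Real.logb_pow, Real.logb_self_eq_one one_lt_two, mul_one]
  have hl3 : Real.logb 2 ((3 * 2 ^ j : ℕ) : ℝ) = Real.logb 2 3 + j := by
    push_cast
    rw [Real.logb_mul (by norm_num) h2.ne', Real.logb_pow, Real.logb_self_eq_one one_lt_two, mul_one]
  rw [hl2, hl3]
  have hs1 : Real.sin (2 * π * (j : ℝ)) = 0 := by
    rw [show 2 * π * (j:ℝ) = ((2 * j : ℕ) : ℝ) * π by push_cast; ring]
    exact Real.sin_nat_mul_pi _
  have hs2 : Real.sin (2 * π * (Real.logb 2 3 + j)) = Real.sin (2 * π * Real.logb 2 3) := by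
    rw [show 2 * π * (Real.logb 2 3 + j) = 2 * π * Real.logb 2 3 + j * (2 * π) by ring]
    exact Real.sin_add_nat_mul_two_pi _ _
  rw [hs1, hs2, mul_zero, Real.exp_zero, mul_one]
  push_cast
  field_simp

/-- The ratio `φ_ε(9r)/φ_ε(3r)` along `r = 2^j`: another constant. [folklore] -/
theorem dsiProfile_ratio_pow' (ε : ℝ) (j : ℕ) :
    dsiProfile ε ((3 * (3 * 2 ^ j) : ℕ)) / dsiProfile ε ((3 * 2 ^ j : ℕ)) =
      3⁻¹ * Real.exp (ε * (Real.sin (2 * (2 * π * Real.logb 2 3)) - Real.sin (2 * π * Real.logb 2 3))) := by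
  unfold dsiProfile
  have h2 : (0:ℝ) < 2 ^ j := by positivity
  have hl3 : Real.logb 2 ((3 * 2 ^ j : ℕ) : ℝ) = Real.logb 2 3 + j := by
    push_cast
    rw [Real.logb_mul (by norm_num) h2.ne', Real.logb_pow, Real.logb_self_eq_one one_lt_two, mul_one]
  have hl9 : Real.logb 2 ((3 * (3 * 2 ^ j) : ℕ) : ℝ) = 2 * Real.logb 2 3 + j := by
    push_cast
    rw [← mul_assoc, Real.logb_mul (by norm_num) h2.ne', Real.logb_pow, Real.logb_self_eq_one one_lt_two,
      mul_one, show (3:ℝ) * 3 = 3 ^ 2 by norm_num, Real.logb_pow]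
    push_cast; ring
  rw [hl3, hl9]
  have hs3 : Real.sin (2 * π * (Real.logb 2 3 + j)) = Real.sin (2 * π * Real.logb 2 3) := by
    rw [show 2 * π * (Real.logb 2 3 + j) = 2 * π * Real.logb 2 3 + j * (2 * π) by ring]
    exact Real.sin_add_nat_mul_two_pi _ _
  have hs9 : Real.sin (2 * π * (2 * Real.logb 2 3 + j)) = Real.sin (2 * (2 * π * Real.logb 2 3)) := by
    rw [show 2 * π * (2 * Real.logb 2 3 + j) = 2 * (2 * π * Real.logb 2 3) + j * (2 * π) by ring]
    exact Real.sin_add_nat_mul_two_pi _ _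
  rw [hs3, hs9]
  have hE : Real.exp (ε * Real.sin (2 * π * Real.logb 2 3)) ≠ 0 := (Real.exp_pos _).ne'
  rw [mul_sub, Real.exp_sub]
  push_cast
  field_simp

/-- The dyadic meshes `(2^j)⁻¹ → 0⁺` and `(3·2^j)⁻¹ → 0⁺`. [folklore] -/
theorem tendsto_inv_natMul_pow_nhdsGT {a : ℕ} (ha : 0 < a) :
    Tendsto (fun j : ℕ => (((a * 2 ^ j : ℕ) : ℝ))⁻¹) atTop (𝓝[>] (0:ℝ)) := by
  refine tendsto_nhdsWithin_iff.2 ⟨?_, Filter.Eventually.of_forall fun j => ?_⟩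
  · refine tendsto_inv_atTop_zero.comp ?_
    refine tendsto_natCast_atTop_atTop.comp ?_
    refine Filter.tendsto_atTop_mono (fun j => ?_) (tendsto_pow_atTop_atTop_of_one_lt one_lt_two)
    exact Nat.le_mul_of_pos_left _ ha
  · show (0:ℝ) < (((a * 2 ^ j : ℕ) : ℝ))⁻¹
    positivity

/-- The trigonometric endgame: `ε sin α = ε (sin 2α − sin α)` with `ε ≠ 0`, `α = 2π log₂ 3`, is
impossible. [folklore] -/
theorem dsi_trig_contra {ε : ℝ} (hε : ε ≠ 0)
    (heq : ε * Real.sin (2 * π * Real.logb 2 3) =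
      ε * (Real.sin (2 * (2 * π * Real.logb 2 3)) - Real.sin (2 * π * Real.logb 2 3))) : False := by
  set α : ℝ := 2 * π * Real.logb 2 3 with hα
  have heq' : Real.sin α = Real.sin (2 * α) - Real.sin α := mul_left_cancel₀ hε heq
  rw [Real.sin_two_mul] at heq'
  have hsin : Real.sin α ≠ 0 := sin_two_pi_logb_three_ne_zero
  have hcos : Real.cos α = 1 := by
    have : Real.sin α * (Real.cos α - 1) = 0 := by linarith
    rcases mul_eq_zero.1 this with h | h
    · exact absurd h hsin
    · linarith
  have : Real.sin α ^ 2 = 0 := by nlinarith [Real.sin_sq_add_cos_sq α]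
  exact hsin (pow_eq_zero_iff two_ne_zero |>.1 this)

/-- **NO FULL-FILTER LIMIT.** For `ε ≠ 0` the family `W_ε` has NO non-degenerate pointwise scaling
limit along the full filter `δ → 0⁺`, whatever the renormalisation: along `δ = 2^{-j}` and
`δ = (3·2^j)⁻¹` the renormalisation-free ratio `W(⌊3/δ⌋e₀)/W(⌊1/δ⌋e₀)` takes two different constant
values, since `sin(2π log₂ 3) ≠ 0`. [folklore] -/
theorem no_limit_of_hasDsiPair {ε : ℝ} (hε : ε ≠ 0) {G : LatticeCorrFamily 3}
    (hG : HasDsiPair ε G) :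
    ¬ ∃ (ρ : ℝ → ℝ) (S : CorrFamily 3),
      HasPointwiseScalingLimit G ρ S ∧ IsNondegenerateTwoPoint S := by
  rintro ⟨ρ, S, hlim, hnd⟩
  have hx₁ := zero_unitVec_mem_nonCoincident (t := (1:ℝ)) one_ne_zero
  have hx₃ := zero_unitVec_mem_nonCoincident (t := (3:ℝ)) (by norm_num)
  have hA := hnd _ hx₁
  have h1 : Tendsto (fun δ => ρ δ ^ 2 * dsiTwoPoint ε (Pi.single 0 ⌊1 / δ⌋)) (𝓝[>] (0:ℝ))
      (𝓝 (S 2 (![0, EuclideanSpace.single 0 1] : Fin 2 → EuclideanSpace ℝ (Fin 3)))) := by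
    have h := (hlim 2).tendsto_at hx₁
    simp_rw [rescaled_dsi_axisPair hG] at h
    exact h
  have h3 : Tendsto (fun δ => ρ δ ^ 2 * dsiTwoPoint ε (Pi.single 0 ⌊3 / δ⌋)) (𝓝[>] (0:ℝ))
      (𝓝 (S 2 (![0, EuclideanSpace.single 0 3] : Fin 2 → EuclideanSpace ℝ (Fin 3)))) := by
    have h := (hlim 2).tendsto_at hx₃
    simp_rw [rescaled_dsi_axisPair hG] at h
    exact h
  -- the renormalisation-free ratio converges along the full filter
  set L : ℝ := S 2 (![0, EuclideanSpace.single 0 3] : Fin 2 → EuclideanSpace ℝ (Fin 3)) /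
    S 2 (![0, EuclideanSpace.single 0 1] : Fin 2 → EuclideanSpace ℝ (Fin 3)) with hL
  have hR : Tendsto (fun δ => dsiTwoPoint ε (Pi.single 0 ⌊3 / δ⌋) / dsiTwoPoint ε (Pi.single 0 ⌊1 / δ⌋))
      (𝓝[>] (0:ℝ)) (𝓝 L) := by
    have hq := h3.div h1 hA.ne'
    have hev : ∀ᶠ δ in 𝓝[>] (0:ℝ), ρ δ ≠ 0 := by
      filter_upwards [h1.eventually_const_lt hA] with δ hδ h0
      rw [h0] at hδ
      simp at hδ
    refine hq.congr' ?_
    filter_upwards [hev] with δ hδ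
    exact mul_div_mul_left _ _ (pow_ne_zero 2 hδ)
  -- along δ = (2^j)⁻¹
  have hu := hR.comp (tendsto_inv_natMul_pow_nhdsGT (a := 1) one_pos)
  have hw := hR.comp (tendsto_inv_natMul_pow_nhdsGT (a := 3) (by norm_num))
  have eu : (fun j : ℕ => dsiTwoPoint ε (Pi.single 0 ⌊3 / (((1 * 2 ^ j : ℕ) : ℝ))⁻¹⌋) /
      dsiTwoPoint ε (Pi.single 0 ⌊1 / (((1 * 2 ^ j : ℕ) : ℝ))⁻¹⌋)) =
      fun _ => 3⁻¹ * Real.exp (ε * Real.sin (2 * π * Real.logb 2 3)) := by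
    funext j
    have e3 : ⌊(3:ℝ) / (((1 * 2 ^ j : ℕ) : ℝ))⁻¹⌋ = ((3 * 2 ^ j : ℕ) : ℤ) := by
      have := floor_div_inv_nat 3 (1 * 2 ^ j)
      push_cast at this ⊢
      simpa [mul_comm, mul_assoc, mul_left_comm] using this
    have e1 : ⌊(1:ℝ) / (((1 * 2 ^ j : ℕ) : ℝ))⁻¹⌋ = ((2 ^ j : ℕ) : ℤ) := by
      have := floor_div_inv_nat 1 (1 * 2 ^ j)
      push_cast at this ⊢
      simpa using this
    rw [e3, e1, dsiTwoPoint_single_nat ε (by positivity), dsiTwoPoint_single_nat ε (by positivity)]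
    exact dsiProfile_ratio_pow ε j
  have ew : (fun j : ℕ => dsiTwoPoint ε (Pi.single 0 ⌊3 / (((3 * 2 ^ j : ℕ) : ℝ))⁻¹⌋) /
      dsiTwoPoint ε (Pi.single 0 ⌊1 / (((3 * 2 ^ j : ℕ) : ℝ))⁻¹⌋)) =
      fun _ => 3⁻¹ * Real.exp (ε * (Real.sin (2 * (2 * π * Real.logb 2 3)) - Real.sin (2 * π * Real.logb 2 3))) := by
    funext j
    have e3 : ⌊(3:ℝ) / (((3 * 2 ^ j : ℕ) : ℝ))⁻¹⌋ = ((3 * (3 * 2 ^ j) : ℕ) : ℤ) := by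
      have := floor_div_inv_nat 3 (3 * 2 ^ j)
      push_cast at this ⊢
      simpa [mul_comm, mul_assoc, mul_left_comm] using this
    have e1 : ⌊(1:ℝ) / (((3 * 2 ^ j : ℕ) : ℝ))⁻¹⌋ = ((3 * 2 ^ j : ℕ) : ℤ) := by
      have := floor_div_inv_nat 1 (3 * 2 ^ j)
      push_cast at this ⊢
      simpa using this
    rw [e3, e1, dsiTwoPoint_single_nat ε (by positivity), dsiTwoPoint_single_nat ε (by positivity)]
    exact dsiProfile_ratio_pow' ε j
  have Lu : L = 3⁻¹ * Real.exp (ε * Real.sin (2 * π * Real.logb 2 3)) := by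
    have hc : Tendsto (fun j : ℕ => dsiTwoPoint ε (Pi.single 0 ⌊3 / (((1 * 2 ^ j : ℕ) : ℝ))⁻¹⌋) /
        dsiTwoPoint ε (Pi.single 0 ⌊1 / (((1 * 2 ^ j : ℕ) : ℝ))⁻¹⌋)) atTop
        (𝓝 (3⁻¹ * Real.exp (ε * Real.sin (2 * π * Real.logb 2 3)))) := by
      rw [eu]; exact tendsto_const_nhds
    exact tendsto_nhds_unique hu hc
  have Lw : L = 3⁻¹ * Real.exp (ε * (Real.sin (2 * (2 * π * Real.logb 2 3)) - Real.sin (2 * π * Real.logb 2 3))) := by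
    have hc : Tendsto (fun j : ℕ => dsiTwoPoint ε (Pi.single 0 ⌊3 / (((3 * 2 ^ j : ℕ) : ℝ))⁻¹⌋) /
        dsiTwoPoint ε (Pi.single 0 ⌊1 / (((3 * 2 ^ j : ℕ) : ℝ))⁻¹⌋)) atTop
        (𝓝 (3⁻¹ * Real.exp (ε * (Real.sin (2 * (2 * π * Real.logb 2 3)) - Real.sin (2 * π * Real.logb 2 3))))) := by
      rw [ew]; exact tendsto_const_nhds
    exact tendsto_nhds_unique hw hc
  -- trigonometric contradiction
  refine dsi_trig_contra hε ?_
  have h := Lu.symm.trans Lw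
  exact Real.exp_injective (mul_left_cancel₀ (by norm_num : (3:ℝ)⁻¹ ≠ 0) h)

/-- In particular for `W_ε` itself. [folklore] -/
theorem dsiFamily_no_limit {ε : ℝ} (hε : ε ≠ 0) :
    ¬ ∃ (ρ : ℝ → ℝ) (S : CorrFamily 3),
      HasPointwiseScalingLimit (dsiFamily ε) ρ S ∧ IsNondegenerateTwoPoint S :=
  no_limit_of_hasDsiPair hε (hasDsiPair_dsiFamily ε)

/-! ### … yet the DYADIC scaling limit of the pair function exists and is non-degenerate -/

/-- The dyadic limit pair function: `φ_ε` of the sup-norm distance. [folklore] -/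
def dsiLimitTwo (ε : ℝ) (x : Fin 2 → EuclideanSpace ℝ (Fin 3)) : ℝ :=
  dsiProfile ε ‖WithLp.ofLp (x 1) - WithLp.ofLp (x 0)‖

theorem dsiProfile_continuousOn (ε : ℝ) : ContinuousOn (dsiProfile ε) {0}ᶜ := by
  unfold dsiProfile
  refine (continuousOn_inv₀.mono fun r hr => hr).mul ?_
  refine ContinuousOn.rexp ?_
  refine continuousOn_const.mul ?_
  refine Real.continuous_sin.comp_continuousOn ?_
  exact continuousOn_const.mul Real.continuousOn_logb

theorem dsiProfile_continuousAt (ε : ℝ) {r : ℝ} (hr : r ≠ 0) : ContinuousAt (dsiProfile ε) r :=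
  (dsiProfile_continuousOn ε).continuousAt (isOpen_compl_singleton.mem_nhds hr)

theorem supDist_pos {x : Fin 2 → EuclideanSpace ℝ (Fin 3)} (hx : x ∈ NonCoincident 3 2) :
    0 < ‖WithLp.ofLp (x 1) - WithLp.ofLp (x 0)‖ := by
  rw [norm_pos_iff, sub_ne_zero, (WithLp.ofLp_injective 2).ne_iff]
  exact ((mem_nonCoincident x).1 hx).ne (by decide)

theorem dsiLimitTwo_pos (ε : ℝ) {x : Fin 2 → EuclideanSpace ℝ (Fin 3)} (hx : x ∈ NonCoincident 3 2) :
    0 < dsiLimitTwo ε x :=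
  dsiProfile_pos ε (supDist_pos hx)

/-- The dyadic limit is continuous off the diagonal. [folklore] -/
theorem dsiLimitTwo_continuousOn (ε : ℝ) : ContinuousOn (dsiLimitTwo ε) (NonCoincident 3 2) := by
  have hd : Continuous fun x : Fin 2 → EuclideanSpace ℝ (Fin 3) => ‖WithLp.ofLp (x 1) - WithLp.ofLp (x 0)‖ := by
    fun_prop
  refine (dsiProfile_continuousOn ε).comp hd.continuousOn fun x hx => ?_
  exact (supDist_pos hx).ne'

/-- The dyadic limit is translation invariant. [folklore] -/
theorem dsiLimitTwo_translate (ε : ℝ) (v : EuclideanSpace ℝ (Fin 3)) (x : Fin 2 → EuclideanSpace ℝ (Fin 3)) :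
    dsiLimitTwo ε (fun i => x i + v) = dsiLimitTwo ε x := by
  unfold dsiLimitTwo
  congr 2
  simp only [WithLp.ofLp_add]
  abel

/-- The dyadic limit IS covariant under the dilation `2` (with `Δ = 1/2`: factor `2⁻¹`). [folklore] -/
theorem dsiLimitTwo_two_smul (ε : ℝ) {x : Fin 2 → EuclideanSpace ℝ (Fin 3)} (hx : x ∈ NonCoincident 3 2) :
    dsiLimitTwo ε (fun i => (2:ℝ) • x i) = 2⁻¹ * dsiLimitTwo ε x := by
  unfold dsiLimitTwo dsiProfile
  have hr := supDist_pos hx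
  set r : ℝ := ‖WithLp.ofLp (x 1) - WithLp.ofLp (x 0)‖ with hrdef
  have h2 : ‖WithLp.ofLp ((2:ℝ) • x 1) - WithLp.ofLp ((2:ℝ) • x 0)‖ = 2 * r := by
    rw [WithLp.ofLp_smul, WithLp.ofLp_smul, ← smul_sub, norm_smul, Real.norm_eq_abs, abs_two]
  rw [h2, Real.logb_mul two_ne_zero hr.ne', Real.logb_self_eq_one one_lt_two,
    show 2 * π * (1 + Real.logb 2 r) = 2 * π * Real.logb 2 r + (1:ℕ) * (2 * π) by push_cast; ring,
    Real.sin_add_nat_mul_two_pi, mul_inv]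
  ring

/-- … but NOT under the dilation `3`, for any exponent whatsoever (`ε ≠ 0`). [folklore] -/
theorem dsiLimitTwo_not_three_covariant {ε : ℝ} (hε : ε ≠ 0) :
    ¬ ∃ Δ : ℝ, ∀ x ∈ NonCoincident 3 2,
      dsiLimitTwo ε (fun i => (3:ℝ) • x i) = (3:ℝ) ^ (-(2:ℝ) * Δ) * dsiLimitTwo ε x := by
  rintro ⟨Δ, h⟩
  have hx₁ := zero_unitVec_mem_nonCoincident (t := (1:ℝ)) one_ne_zero
  have hx₃ := zero_unitVec_mem_nonCoincident (t := (3:ℝ)) (by norm_num)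
  have e₁ := h _ hx₁
  have e₃ := h _ hx₃
  -- distances `1`, `3`, `3`, `9`
  have d1 : ‖WithLp.ofLp ((![0, EuclideanSpace.single 0 1] : Fin 2 → EuclideanSpace ℝ (Fin 3)) 1) -
      WithLp.ofLp ((![0, EuclideanSpace.single 0 1] : Fin 2 → EuclideanSpace ℝ (Fin 3)) 0)‖ = 1 := by
    simp only [Matrix.cons_val_zero, Matrix.cons_val_one, Matrix.cons_val_fin_one,
      WithLp.ofLp_zero, sub_zero, PiLp.ofLp_single, Pi.norm_single, Real.norm_eq_abs, abs_one]
  have d3 : ‖WithLp.ofLp ((![0, EuclideanSpace.single 0 3] : Fin 2 → EuclideanSpace ℝ (Fin 3)) 1) -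
      WithLp.ofLp ((![0, EuclideanSpace.single 0 3] : Fin 2 → EuclideanSpace ℝ (Fin 3)) 0)‖ = 3 := by
    simp only [Matrix.cons_val_zero, Matrix.cons_val_one, Matrix.cons_val_fin_one,
      WithLp.ofLp_zero, sub_zero, PiLp.ofLp_single, Pi.norm_single, Real.norm_eq_abs]
    norm_num
  have d3' : ‖WithLp.ofLp ((3:ℝ) • (![0, EuclideanSpace.single 0 1] : Fin 2 → EuclideanSpace ℝ (Fin 3)) 1) -
      WithLp.ofLp ((3:ℝ) • (![0, EuclideanSpace.single 0 1] : Fin 2 → EuclideanSpace ℝ (Fin 3)) 0)‖ = 3 := by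
    rw [WithLp.ofLp_smul, WithLp.ofLp_smul, ← smul_sub, norm_smul, d1]; norm_num
  have d9 : ‖WithLp.ofLp ((3:ℝ) • (![0, EuclideanSpace.single 0 3] : Fin 2 → EuclideanSpace ℝ (Fin 3)) 1) -
      WithLp.ofLp ((3:ℝ) • (![0, EuclideanSpace.single 0 3] : Fin 2 → EuclideanSpace ℝ (Fin 3)) 0)‖ = 3 * 3 := by
    rw [WithLp.ofLp_smul, WithLp.ofLp_smul, ← smul_sub, norm_smul, d3]; norm_num
  unfold dsiLimitTwo at e₁ e₃
  rw [d3', d1] at e₁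
  rw [d9, d3] at e₃
  -- rewrite through the `2^j` ratio lemmas at `j = 0`
  have r1 := dsiProfile_ratio_pow ε 0
  have r2 := dsiProfile_ratio_pow' ε 0
  simp only [pow_zero, mul_one, Nat.cast_ofNat, Nat.cast_one, Nat.cast_mul] at r1 r2
  have hp1 : dsiProfile ε 1 ≠ 0 := (dsiProfile_pos ε one_pos).ne'
  have hp3 : dsiProfile ε 3 ≠ 0 := (dsiProfile_pos ε (by norm_num)).ne'
  have q1 : dsiProfile ε 3 / dsiProfile ε 1 = (3:ℝ) ^ (-(2:ℝ) * Δ) := by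
    rw [e₁, mul_div_assoc, div_self hp1, mul_one]
  have q2 : dsiProfile ε (3 * 3) / dsiProfile ε 3 = (3:ℝ) ^ (-(2:ℝ) * Δ) := by
    rw [e₃, mul_div_assoc, div_self hp3, mul_one]
  refine dsi_trig_contra hε ?_
  have h := (r1.symm.trans (q1.trans q2.symm)).trans r2
  exact Real.exp_injective (mul_left_cancel₀ (by norm_num : (3:ℝ)⁻¹ ≠ 0) h)

/-- **THE DYADIC SCALING LIMIT OF THE PAIR FUNCTION EXISTS** (pointwise at every non-coincident pair;
renormalisation `ρ(δ) = δ^{-1/2}`, i.e. `Δ = 1/2`): along `δ = 2^{-j}` the rescaled pair correlator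
of any family with the pair function `W_ε` converges to `dsiLimitTwo ε` — positive, continuous off
the diagonal, translation invariant, `2`-covariant. (Local uniformity also holds, by the same
estimate uniformly on compacts; not needed here.) [folklore] -/
theorem dsi_dyadic_tendsto {ε : ℝ} {G : LatticeCorrFamily 3} (hG : HasDsiPair ε G)
    {x : Fin 2 → EuclideanSpace ℝ (Fin 3)} (hx : x ∈ NonCoincident 3 2) :
    Tendsto (fun j : ℕ => rescaledCorrelator G (fun δ => δ ^ (-(1/2:ℝ))) 2 (((2:ℝ) ^ j)⁻¹) x)
      atTop (𝓝 (dsiLimitTwo ε x)) := by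
  have hr0 := supDist_pos hx
  set r : ℝ := ‖WithLp.ofLp (x 1) - WithLp.ofLp (x 0)‖ with hr
  set δ : ℕ → ℝ := fun j => ((2:ℝ) ^ j)⁻¹ with hδ
  have hδpos : ∀ j, 0 < δ j := fun j => by positivity
  have hδ0 : Tendsto δ atTop (𝓝 0) :=
    tendsto_inv_atTop_zero.comp (tendsto_pow_atTop_atTop_of_one_lt one_lt_two)
  set z : ℕ → Site 3 := fun j => latticeApprox (δ j) (x 1) - latticeApprox (δ j) (x 0) with hz
  set t : ℕ → ℝ := fun j => δ j * ‖z j‖ with ht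
  have hbd : ∀ j, r - 2 * δ j ≤ t j ∧ t j ≤ r + 2 * δ j := by
    intro j
    have hup := supNorm_latticeApprox_sub_le (hδpos j) (x 1) (x 0)
    have hlo := le_supNorm_latticeApprox_sub (d := 3) (by norm_num) (hδpos j) (x 1) (x 0)
    rw [← Site.norm_eq_supNorm] at hup hlo
    have hδj := hδpos j
    constructor
    · have := mul_le_mul_of_nonneg_left hlo hδj.le
      rw [mul_sub, mul_div_cancel₀ _ hδj.ne'] at this
      show r - 2 * δ j ≤ δ j * ‖z j‖
      linarith
    · have := mul_le_mul_of_nonneg_left hup hδj.le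
      rw [mul_add, mul_div_cancel₀ _ hδj.ne'] at this
      show δ j * ‖z j‖ ≤ r + 2 * δ j
      linarith
  have ht_t : Tendsto t atTop (𝓝 r) := by
    have hlo : Tendsto (fun j => r - 2 * δ j) atTop (𝓝 r) := by
      simpa using tendsto_const_nhds.sub (hδ0.const_mul 2)
    have hhi : Tendsto (fun j => r + 2 * δ j) atTop (𝓝 r) := by
      simpa using tendsto_const_nhds.add (hδ0.const_mul 2)
    exact tendsto_of_tendsto_of_tendsto_of_le_of_le hlo hhi (fun j => (hbd j).1) fun j => (hbd j).2
  have hev : ∀ᶠ j in atTop, 0 < t j := ht_t.eventually (lt_mem_nhds hr0)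
  have hid : ∀ j, 0 < t j → rescaledCorrelator G (fun δ => δ ^ (-(1/2:ℝ))) 2 (δ j) x = dsiProfile ε (t j) := by
    intro j htj
    have hz0 : z j ≠ 0 := by
      intro h
      have : t j = 0 := by show δ j * ‖z j‖ = 0; rw [h, norm_zero, mul_zero]
      rw [this] at htj
      exact lt_irrefl _ htj
    have hzpos : 0 < ‖z j‖ := norm_pos_iff.2 hz0
    rw [rescaledCorrelator_apply, hG]
    show (δ j ^ (-(1/2:ℝ))) ^ 2 * dsiTwoPoint ε (z j) = dsiProfile ε (t j)
    unfold dsiTwoPoint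
    rw [if_neg hz0]
    have hρ : (δ j ^ (-(1/2:ℝ))) ^ 2 = (δ j)⁻¹ := by
      rw [← Real.rpow_natCast, ← Real.rpow_mul (hδpos j).le]
      norm_num
      exact Real.rpow_neg_one _
    rw [hρ]
    unfold dsiProfile
    have hlog : Real.logb 2 ‖z j‖ = Real.logb 2 (t j) + j := by
      show Real.logb 2 ‖z j‖ = Real.logb 2 (δ j * ‖z j‖) + j
      rw [Real.logb_mul (hδpos j).ne' hzpos.ne']
      show Real.logb 2 ‖z j‖ = Real.logb 2 (((2:ℝ) ^ j)⁻¹) + Real.logb 2 ‖z j‖ + j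
      rw [Real.logb_inv, Real.logb_pow, Real.logb_self_eq_one one_lt_two]
      ring
    rw [hlog, show 2 * π * (Real.logb 2 (t j) + j) = 2 * π * Real.logb 2 (t j) + j * (2 * π) by ring,
      Real.sin_add_nat_mul_two_pi]
    show (δ j)⁻¹ * (‖z j‖⁻¹ * Real.exp (ε * Real.sin (2 * π * Real.logb 2 (t j)))) =
      (δ j * ‖z j‖)⁻¹ * Real.exp (ε * Real.sin (2 * π * Real.logb 2 (δ j * ‖z j‖)))
    rw [mul_inv]
    ring
  have hcont : Tendsto (fun j => dsiProfile ε (t j)) atTop (𝓝 (dsiProfile ε r)) :=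
    ((dsiProfile_continuousAt ε hr0.ne').tendsto).comp ht_t
  refine hcont.congr' ?_
  filter_upwards [hev] with j hj
  exact (hid j hj).symm

/-! ### Lattice point-group symmetry of `W_ε` (as for the n.n. Ising pair function) -/

theorem dsiTwoPoint_eq_of_norm_eq (ε : ℝ) {z z' : Site 3} (h : ‖z‖ = ‖z'‖) :
    dsiTwoPoint ε z = dsiTwoPoint ε z' := by
  unfold dsiTwoPoint
  have hiff : z = 0 ↔ z' = 0 := by rw [← norm_eq_zero, h, norm_eq_zero]
  by_cases hz : z = 0
  · rw [if_pos hz, if_pos (hiff.1 hz)]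
  · rw [if_neg hz, if_neg (mt hiff.2 hz), h]

theorem norm_comp_perm (z : Site 3) (σ : Equiv.Perm (Fin 3)) : ‖(fun i => z (σ i) : Site 3)‖ = ‖z‖ := by
  simp only [Pi.norm_def]
  congr 1
  apply le_antisymm
  · exact Finset.sup_le fun i _ => Finset.le_sup (f := fun b => ‖z b‖₊) (Finset.mem_univ (σ i))
  · refine Finset.sup_le fun i _ => ?_
    have := Finset.le_sup (f := fun b => ‖(fun i => z (σ i) : Site 3) b‖₊) (Finset.mem_univ (σ.symm i))
    simpa using this

theorem norm_update_neg (z : Site 3) (i : Fin 3) : ‖Function.update z i (-z i)‖ = ‖z‖ := by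
  simp only [Pi.norm_def]
  congr 1
  refine Finset.sup_congr rfl fun b _ => ?_
  by_cases hb : b = i
  · subst hb; simp
  · simp [Function.update_of_ne hb]

/-- Coordinate permutations. [folklore] -/
theorem dsiTwoPoint_perm (ε : ℝ) (z : Site 3) (σ : Equiv.Perm (Fin 3)) :
    dsiTwoPoint ε (fun i => z (σ i)) = dsiTwoPoint ε z :=
  dsiTwoPoint_eq_of_norm_eq ε (norm_comp_perm z σ)

/-- Coordinate sign changes. [folklore] -/
theorem dsiTwoPoint_reflect (ε : ℝ) (z : Site 3) (i : Fin 3) :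
    dsiTwoPoint ε (Function.update z i (-z i)) = dsiTwoPoint ε z :=
  dsiTwoPoint_eq_of_norm_eq ε (norm_update_neg z i)

/-! ### The crux SHAPE, and its failure for every family with the pair function `W_ε` -/

/-- The shape of the crux for a general lattice family `G` in place of `criticalCorr 3`. [folklore] -/
def CruxShape (G : LatticeCorrFamily 3) : Prop :=
  ∃ (ρ : ℝ → ℝ) (Δ : ℝ) (S : CorrFamily 3), (∀ δ ∈ Set.Ioc (0:ℝ) 1, 0 < ρ δ) ∧ 0 < Δ ∧
    HasPointwiseScalingLimit G ρ S ∧ (∀ n z, z ∉ NonCoincident 3 n → S n z = 0) ∧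
      IsNondegenerateTwoPoint S ∧ IsTranslationInvariant S ∧ IsScaleCovariant Δ S

/-- **The crux shape FAILS for every lattice family with the pair function `W_ε`** (`ε ≠ 0`), whatever
its higher-order correlations. [folklore] -/
theorem not_cruxShape_of_hasDsiPair {ε : ℝ} (hε : ε ≠ 0) {G : LatticeCorrFamily 3}
    (hG : HasDsiPair ε G) : ¬ CruxShape G := by
  rintro ⟨ρ, Δ, S, -, -, hlim, -, hnd, -, -⟩
  exact no_limit_of_hasDsiPair hε hG ⟨ρ, S, hlim, hnd⟩

/-- **LOAD-BEARING SUMMARY (definition-free packaging, landable).** There is a lattice family on `ℤ³`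
sharing with `criticalCorr 3` every two-point feature the tree knows — lattice translation
invariance, vanishing odd orders, symmetric pair function invariant under the lattice point group
(coordinate permutations and sign changes), `0 < G₂ ≤ 1`, the two rigorous power bounds
`c‖z‖⁻² ≤ G₂ ≤ C‖z‖⁻¹` of `criticalTwoPoint_bounds` — whose rescaled pair correlators CONVERGE along the
dyadic meshes `2^{-j}` (renormalisation `δ^{-1/2}`) at every non-coincident pair to a positive,
continuous, translation-invariant, `2`-covariant function that is `3`-covariant for NO exponent, and
which admits NO non-degenerate pointwise scaling limit along the full filter `δ → 0⁺`, for ANY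
renormalisation. So in the crux the full filter `𝓝[>] 0` is load-bearing, and any proof must consume an
input about the critical Ising correlators outside this list. [folklore] -/
theorem exists_discretelySelfSimilar_family :
    ∃ G : LatticeCorrFamily 3,
      (∀ (n : ℕ) (y : Fin n → Site 3) (v : Site 3), G n (fun i => y i + v) = G n y) ∧
      (∀ n, Odd n → ∀ y : Fin n → Site 3, G n y = 0) ∧
      (∀ a b : Site 3, G 2 ![a, b] = G 2 ![b, a]) ∧
      (∀ (y : Fin 2 → Site 3) (σ : Equiv.Perm (Fin 3)), G 2 (fun k i => y k (σ i)) = G 2 y) ∧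
      (∀ (y : Fin 2 → Site 3) (i : Fin 3), G 2 (fun k => Function.update (y k) i (-(y k i))) = G 2 y) ∧
      (∀ y : Fin 2 → Site 3, 0 < G 2 y ∧ G 2 y ≤ 1) ∧
      (∃ c C : ℝ, 0 < c ∧ ∀ y : Fin 2 → Site 3, y 1 - y 0 ≠ 0 →
        c * ‖y 1 - y 0‖ ^ (-((3 : ℝ) - 1)) ≤ G 2 y ∧ G 2 y ≤ C * ‖y 1 - y 0‖ ^ (-((3 : ℝ) - 2))) ∧
      (∃ S₂ : (Fin 2 → EuclideanSpace ℝ (Fin 3)) → ℝ,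
        (∀ x ∈ NonCoincident 3 2, 0 < S₂ x) ∧ ContinuousOn S₂ (NonCoincident 3 2) ∧
        (∀ (v : EuclideanSpace ℝ (Fin 3)) (x : Fin 2 → EuclideanSpace ℝ (Fin 3)),
          S₂ (fun i => x i + v) = S₂ x) ∧
        (∀ x ∈ NonCoincident 3 2, S₂ (fun i => (2:ℝ) • x i) = 2⁻¹ * S₂ x) ∧
        (¬ ∃ Δ : ℝ, ∀ x ∈ NonCoincident 3 2, S₂ (fun i => (3:ℝ) • x i) = (3:ℝ) ^ (-(2:ℝ) * Δ) * S₂ x) ∧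
        (∀ x ∈ NonCoincident 3 2, Tendsto
          (fun j : ℕ => rescaledCorrelator G (fun δ => δ ^ (-(1/2:ℝ))) 2 (((2:ℝ) ^ j)⁻¹) x)
          atTop (𝓝 (S₂ x)))) ∧
      ¬ ∃ (ρ : ℝ → ℝ) (S : CorrFamily 3), HasPointwiseScalingLimit G ρ S ∧ IsNondegenerateTwoPoint S := by
  have hε : (1/4 : ℝ) ≠ 0 := by norm_num
  have hε' : |(1/4 : ℝ)| ≤ 1/2 := by rw [abs_of_pos (by norm_num)]; norm_num
  refine ⟨dsiFamily (1/4), fun n y v => dsiFamily_translate _ y v, fun n hn y => dsiFamily_odd _ hn y,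
    dsiFamily_two_comm _, ?_, ?_, ?_, ?_, ?_, dsiFamily_no_limit hε⟩
  · intro y σ
    rw [dsiFamily_two, dsiFamily_two]
    exact dsiTwoPoint_perm _ (y 1 - y 0) σ
  · intro y i
    rw [dsiFamily_two, dsiFamily_two]
    have h : Function.update (y 1) i (-y 1 i) - Function.update (y 0) i (-y 0 i) =
        Function.update (y 1 - y 0) i (-(y 1 - y 0) i) := by
      funext k
      by_cases hk : k = i
      · subst hk; simp; abel
      · simp [Function.update_of_ne hk]
    rw [h]
    exact dsiTwoPoint_reflect _ _ i
  · intro y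
    rw [dsiFamily_two]
    exact ⟨dsiTwoPoint_pos _ _, dsiTwoPoint_le_one hε' _⟩
  · obtain ⟨c, C, hc, hb⟩ := dsiTwoPoint_bounds (1/4)
    exact ⟨c, C, hc, fun y hy => by rw [dsiFamily_two]; exact hb _ hy⟩
  · exact ⟨dsiLimitTwo (1/4), fun x hx => dsiLimitTwo_pos _ hx, dsiLimitTwo_continuousOn _,
      dsiLimitTwo_translate _, fun x hx => dsiLimitTwo_two_smul _ hx,
      dsiLimitTwo_not_three_covariant hε, fun x hx => dsi_dyadic_tendsto (hasDsiPair_dsiFamily _) hx⟩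

/-- The crux IS the crux shape at `criticalCorr 3` (definitional). [folklore] -/
theorem cruxShape_criticalCorr_iff :
    CruxShape (criticalCorr 3) ↔ HyperoctahedralRP.ExistsScaleCovariantLimit := Iff.rfl


/-! ## §H  crux ⟺ TIGHTNESS ∧ UNIQUENESS of the pinned zoom (the ω-limit-set formulation) -/

/-- **Sequential precompactness of the pinned zoom** (tightness): every mesh sequence in `(0,1]`
tending to `0⁺` has a subsequence along which the pinned rescaled critical correlators converge
locally uniformly off the diagonals, for every `n` simultaneously. [folklore] -/
def PinnedPrecompact : Prop :=
  ∀ u : ℕ → ℝ, (∀ k, u k ∈ Set.Ioc (0:ℝ) 1) → Tendsto u atTop (𝓝[>] (0:ℝ)) →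
    ∃ φ : ℕ → ℕ, StrictMono φ ∧ ∃ S : CorrFamily 3, ∀ n,
      TendstoLocallyUniformlyOn (fun k => rescaledCorrelator (criticalCorr 3) rhoPin n (u (φ k)))
        (S n) atTop (NonCoincident 3 n)

/-- **Uniqueness of the cluster point** of the pinned zoom off the diagonals. [folklore] -/
def PinnedUniqueClusterPoint : Prop :=
  ∀ S S' : CorrFamily 3, IsClusterPoint S → IsClusterPoint S' →
    ∀ n, Set.EqOn (S n) (S' n) (NonCoincident 3 n)

/-- A mesh sequence tending to `0⁺` lies in `(0,1]` eventually; WLOG always (harmless helper). [folklore] -/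
theorem tendsto_one_div_succ : Tendsto (fun k : ℕ => 1 / ((k:ℝ) + 1)) atTop (𝓝[>] (0:ℝ)) :=
  tendsto_div_succ_nhdsGT one_pos

theorem one_div_succ_mem (k : ℕ) : 1 / ((k:ℝ) + 1) ∈ Set.Ioc (0:ℝ) 1 := by
  constructor
  · positivity
  · rw [div_le_one (by positivity)]; linarith [k.cast_nonneg (α := ℝ)]

/-- **The pinned zoom converges ⟺ it is tight AND has a unique cluster point.** [folklore] -/
theorem pinnedLimit_iff_precompact_and_unique :
    (∃ S : CorrFamily 3, HasPointwiseScalingLimit (criticalCorr 3) rhoPin S) ↔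
      PinnedPrecompact ∧ PinnedUniqueClusterPoint := by
  constructor
  · rintro ⟨S, hlim⟩
    refine ⟨fun u _ hu => ⟨id, strictMono_id, S, fun n => tendstoLocallyUniformlyOn_comp_tendsto (hlim n) hu⟩,
      fun S₁ S₂ h₁ h₂ n x hx => ?_⟩
    obtain ⟨u₁, hu₁, hc₁⟩ := h₁
    obtain ⟨u₂, hu₂, hc₂⟩ := h₂
    have e₁ : S₁ n x = S n x :=
      tendsto_nhds_unique ((hc₁ n).tendsto_at hx) (((hlim n).tendsto_at hx).comp hu₁)
    have e₂ : S₂ n x = S n x :=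
      tendsto_nhds_unique ((hc₂ n).tendsto_at hx) (((hlim n).tendsto_at hx).comp hu₂)
    rw [e₁, e₂]
  · rintro ⟨hpc, huq⟩
    -- a reference cluster point
    obtain ⟨φ₀, hφ₀, S₀, h₀⟩ := hpc _ one_div_succ_mem tendsto_one_div_succ
    have hS₀ : IsClusterPoint S₀ :=
      ⟨fun k => 1 / (((φ₀ k : ℕ) : ℝ) + 1), tendsto_one_div_succ.comp hφ₀.tendsto_atTop, h₀⟩
    refine ⟨S₀, fun n => ?_⟩
    rw [tendstoLocallyUniformlyOn_iff_forall_isCompact (isOpen_nonCoincident 3 n)]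
    intro K hK hKc
    rw [Metric.tendstoUniformlyOn_iff]
    intro ε hε
    by_contra hnot
    have hfreq : ∃ᶠ δ in 𝓝[>] (0:ℝ), δ ∈ Set.Ioc (0:ℝ) 1 ∧
        ¬ ∀ x ∈ K, dist (S₀ n x) (rescaledCorrelator (criticalCorr 3) rhoPin n δ x) < ε :=
      ((Filter.not_eventually.1 hnot).and_eventually (Ioc_mem_nhdsGT one_pos)).mono
        fun δ h => ⟨h.2, h.1⟩
    obtain ⟨v, hv, hbad⟩ := exists_seq_forall_of_frequently hfreq
    obtain ⟨φ, hφ, S, hS⟩ := hpc v (fun k => (hbad k).1) hv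
    have hSc : IsClusterPoint S := ⟨v ∘ φ, hv.comp hφ.tendsto_atTop, hS⟩
    have hS' : TendstoLocallyUniformlyOn
        (fun k => rescaledCorrelator (criticalCorr 3) rhoPin n (v (φ k))) (S₀ n) atTop
        (NonCoincident 3 n) := (hS n).congr_right (huq S S₀ hSc hS₀ n)
    have hU := (tendstoLocallyUniformlyOn_iff_forall_isCompact (isOpen_nonCoincident 3 n)).1 hS' K hK hKc
    obtain ⟨k, hk⟩ := (Metric.tendstoUniformlyOn_iff.1 hU ε hε).exists
    exact (hbad (φ k)).2 hk

/-- **crux ⟺ TIGHTNESS ∧ UNIQUENESS.** [folklore] -/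
theorem crux_iff_precompact_and_unique :
    HyperoctahedralRP.ExistsScaleCovariantLimit ↔ PinnedPrecompact ∧ PinnedUniqueClusterPoint :=
  iff_pinned.trans pinnedLimit_iff_precompact_and_unique

/-! ### The tightness half is route `MonotoneRG`'s item `OrbitPrecompact` (stmt-CriticalPhenomena-5955) -/

/-- A sequential locally uniform limit of rescaled correlators is locally bounded. [folklore] -/
theorem seqLimit_isBoundedUnder {ρ : ℝ → ℝ} {S : CorrFamily 3} {u : ℕ → ℝ} (n : ℕ)
    (h : TendstoLocallyUniformlyOn (fun k => rescaledCorrelator (criticalCorr 3) ρ n (u k)) (S n)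
      atTop (NonCoincident 3 n))
    {x : Fin n → EuclideanSpace ℝ (Fin 3)} (hx : x ∈ NonCoincident 3 n) :
    (𝓝[NonCoincident 3 n] x).IsBoundedUnder (· ≤ ·) (fun y => dist (S n y) 0) := by
  obtain ⟨t, ht, hev⟩ := (Metric.tendstoLocallyUniformlyOn_iff.1 h) 1 one_pos x hx
  obtain ⟨k, hk⟩ := hev.exists
  refine isBoundedUnder_of_eventually_le (a := |ρ (u k)| ^ n + 1) ?_
  filter_upwards [ht] with y hy
  have h1 := hk y hy
  rw [Real.dist_eq] at h1
  rw [Real.dist_eq, sub_zero]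
  have h2 := abs_rescaledCorrelator_le ρ n (u k) y
  have h3 := abs_sub_abs_le_abs_sub (S n y) (rescaledCorrelator (criticalCorr 3) ρ n (u k) y)
  linarith

/-- **`OrbitPrecompact` (any `ρ`, non-degenerate cluster points) ⟹ tightness of the PINNED zoom**:
pin the subsequential limit by its value at `(0,e₀)`. [folklore] -/
theorem pinnedPrecompact_of_orbitPrecompact (h : MonotoneRG.OrbitPrecompact) : PinnedPrecompact := by
  obtain ⟨ρ, hρ, h⟩ := h
  intro u hu1 hu
  have hu0 : Tendsto u atTop (𝓝 0) := tendsto_nhdsWithin_iff.1 hu |>.1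
  obtain ⟨φ, S, hφ, hnd, hconv⟩ := h u hu1 hu0
  set cfg : Fin 2 → EuclideanSpace ℝ (Fin 3) := ![0, EuclideanSpace.single 0 1] with hcfg
  have hA : 0 < S 2 cfg := hnd _ cfg01_mem
  refine ⟨φ, hφ, fun n x => ((S 2 cfg) ^ (-(1 / 2 : ℝ))) ^ n * S n x, fun n => ?_⟩
  set r : ℕ → ℝ := fun k => (rescaledCorrelator (criticalCorr 3) ρ 2 (u (φ k)) cfg) ^ (-(1 / 2 : ℝ))
    with hr
  have hr_t : Tendsto (fun k => r k ^ n) atTop (𝓝 (((S 2 cfg) ^ (-(1 / 2 : ℝ))) ^ n)) := by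
    have h2 : Tendsto (fun k => rescaledCorrelator (criticalCorr 3) ρ 2 (u (φ k)) cfg) atTop
        (𝓝 (S 2 cfg)) := (hconv 2).tendsto_at cfg01_mem
    exact (h2.rpow_const (p := -(1 / 2 : ℝ)) (Or.inl hA.ne')).pow n
  have hF1 : TendstoLocallyUniformlyOn (fun k (_ : Fin n → EuclideanSpace ℝ (Fin 3)) => r k ^ n)
      (fun _ => ((S 2 cfg) ^ (-(1 / 2 : ℝ))) ^ n) atTop (NonCoincident 3 n) :=
    (hr_t.tendstoUniformlyOn_const (NonCoincident 3 n)).tendstoLocallyUniformlyOn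
  have hprod := hF1.mul₀_of_isBoundedUnder (hconv n)
    (fun x _ => isBoundedUnder_of ⟨dist (((S 2 cfg) ^ (-(1 / 2 : ℝ))) ^ n) 0, fun _ => le_rfl⟩)
    (fun x hx => seqLimit_isBoundedUnder n (hconv n) hx)
  refine hprod.congr fun k y _ => ?_
  exact (rescaled_pin_eq (hρ _ (hu1 (φ k))) n y).symm

/-- Conversely the pinned limit gives `OrbitPrecompact` with `ρ = ρ_pin`. [folklore] -/
theorem orbitPrecompact_of_pinnedLimit {S : CorrFamily 3}
    (hlim : HasPointwiseScalingLimit (criticalCorr 3) rhoPin S) : MonotoneRG.OrbitPrecompact := by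
  have hρ : ∀ δ ∈ Set.Ioc (0:ℝ) 1, 0 < rhoPin δ := fun δ _ =>
    Real.rpow_pos_of_pos (criticalTwoPoint_pos3 _) _
  have h1 : S 2 (![0, EuclideanSpace.single 0 1] : Fin 2 → EuclideanSpace ℝ (Fin 3)) = 1 := by
    have h := (hlim 2).tendsto_at cfg01_mem
    simp_rw [rescaled_pin_cfg01] at h
    exact (tendsto_nhds_unique tendsto_const_nhds h).symm
  have hnd : IsNondegenerateTwoPoint S :=
    (isNondegenerateTwoPoint_iff_exists_pos hlim).2 ⟨_, cfg01_mem, by rw [h1]; exact one_pos⟩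
  refine ⟨rhoPin, hρ, fun u hu1 hu0 => ⟨id, S, strictMono_id, hnd, fun n => ?_⟩⟩
  have hu : Tendsto u atTop (𝓝[>] (0:ℝ)) :=
    tendsto_nhdsWithin_iff.2 ⟨hu0, Filter.Eventually.of_forall fun k => (hu1 k).1⟩
  exact tendstoLocallyUniformlyOn_comp_tendsto (hlim n) hu

/-- **crux ⟺ `OrbitPrecompact` (item 5955 of route `MonotoneRG`) ∧ uniqueness of the pinned cluster
point.** What the monotone-dynamics mechanism must deliver on top of its compactness crux is EXACTLY
uniqueness of the ω-limit point. [folklore] -/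
theorem crux_iff_orbitPrecompact_and_unique :
    HyperoctahedralRP.ExistsScaleCovariantLimit ↔
      MonotoneRG.OrbitPrecompact ∧ PinnedUniqueClusterPoint := by
  rw [iff_pinned]
  constructor
  · intro h
    obtain ⟨S, hlim⟩ := h
    exact ⟨orbitPrecompact_of_pinnedLimit hlim, (pinnedLimit_iff_precompact_and_unique.1 ⟨S, hlim⟩).2⟩
  · rintro ⟨hpc, huq⟩
    exact pinnedLimit_iff_precompact_and_unique.2 ⟨pinnedPrecompact_of_orbitPrecompact hpc, huq⟩

/-! ### Tightness alone already contains an open lattice statement: axis doubling -/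

/-- **`PinnedPrecompact` ⟹ AXIS DOUBLING of `⟨σ₀σ_x⟩_{β_c}` is bounded**: for every `0 < s`, the
ratio `⟨σ₀σ_{⌊s(k+1)⌋e₀}⟩ / ⟨σ₀σ_{(k+1)e₀}⟩` is eventually bounded in `k` (contentful for `s < 1`; open
on `ℤ³`, cf. sibling `LocalBoundsDoubling`). So the tightness half of the crux is itself not a
consequence of the known two-point bounds. [folklore] -/
theorem axisRatio_bounded_of_pinnedPrecompact (h : PinnedPrecompact) {s : ℝ} (hs : 0 < s) :
    ∃ B : ℝ, ∀ᶠ k : ℕ in atTop,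
      criticalTwoPoint 3 (Pi.single 0 ⌊s * ((k:ℝ) + 1)⌋) / criticalTwoPoint 3 (Pi.single 0 (((k + 1 : ℕ) : ℤ))) ≤ B := by
  -- the ratio is the pinned zoom at `(0, s e₀)` along `δ = 1/(k+1)`
  set r : ℕ → ℝ := fun k => rescaledCorrelator (criticalCorr 3) rhoPin 2 (1 / ((k:ℝ) + 1))
    (![0, EuclideanSpace.single 0 s] : Fin 2 → EuclideanSpace ℝ (Fin 3)) with hr
  have hr_eq : ∀ k : ℕ, r k = criticalTwoPoint 3 (Pi.single 0 ⌊s * ((k:ℝ) + 1)⌋) /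
      criticalTwoPoint 3 (Pi.single 0 (((k + 1 : ℕ) : ℤ))) := by
    intro k
    show rescaledCorrelator (criticalCorr 3) rhoPin 2 (1 / ((k:ℝ) + 1))
      (![0, EuclideanSpace.single 0 s] : Fin 2 → EuclideanSpace ℝ (Fin 3)) = _
    rw [rescaled_pin_cfg0s]
    have e1 : s / (1 / ((k:ℝ) + 1)) = s * ((k:ℝ) + 1) := by field_simp
    have e2 : (1:ℝ) / (1 / ((k:ℝ) + 1)) = ((k + 1 : ℕ) : ℝ) := by push_cast; field_simp
    rw [e1, e2, Int.floor_natCast]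
  by_contra hnot
  push Not at hnot
  have hfreq : ∀ n : ℕ, ∃ᶠ k in atTop, (n:ℝ) < r k := by
    intro n
    have := hnot n
    refine this.mono fun k hk => ?_
    rw [hr_eq k]; exact hk
  obtain ⟨φ, hφ, hφr⟩ := Filter.extraction_forall_of_frequently hfreq
  set u : ℕ → ℝ := fun j => 1 / (((φ j : ℕ) : ℝ) + 1) with hu
  have hu1 : ∀ j, u j ∈ Set.Ioc (0:ℝ) 1 := fun j => one_div_succ_mem (φ j)
  have hut : Tendsto u atTop (𝓝[>] (0:ℝ)) := tendsto_one_div_succ.comp hφ.tendsto_atTop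
  obtain ⟨ψ, hψ, S, hS⟩ := h u hu1 hut
  have hconv : Tendsto (fun j => r (φ (ψ j))) atTop
      (𝓝 (S 2 (![0, EuclideanSpace.single 0 s] : Fin 2 → EuclideanSpace ℝ (Fin 3)))) :=
    (hS 2).tendsto_at (zero_unitVec_mem_nonCoincident hs.ne')
  set a := S 2 (![0, EuclideanSpace.single 0 s] : Fin 2 → EuclideanSpace ℝ (Fin 3)) with ha
  have hev := hconv.eventually (Iio_mem_nhds (lt_add_one a))
  obtain ⟨j, hj1, hj2⟩ := (hev.and (eventually_gt_atTop ⌈a + 1⌉₊)).exists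
  have h1 : ((ψ j : ℕ) : ℝ) < r (φ (ψ j)) := hφr (ψ j)
  have h2 : j ≤ ψ j := hψ.id_le j
  have h3 : (⌈a + 1⌉₊ : ℝ) < ((ψ j : ℕ) : ℝ) := by exact_mod_cast hj2.trans_le h2
  have h4 : a + 1 ≤ (⌈a + 1⌉₊ : ℝ) := Nat.le_ceil _
  have h5 : r (φ (ψ j)) < a + 1 := hj1
  linarith


namespace Dyadic

/-! ## §I  crux ⟺ the DYADIC pinned zoom converges to a scale-covariant limit -/

/-- The dyadic meshes `2^{-k}`. [folklore] -/
def dyad (k : ℕ) : ℝ := ((2:ℝ) ^ k)⁻¹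

theorem dyad_pos (k : ℕ) : 0 < dyad k := by unfold dyad; positivity

theorem dyad_le_one (k : ℕ) : dyad k ≤ 1 := by
  unfold dyad
  exact inv_le_one_of_one_le₀ (one_le_pow₀ one_le_two)

theorem dyad_mem (k : ℕ) : dyad k ∈ Set.Ioc (0:ℝ) 1 := ⟨dyad_pos k, dyad_le_one k⟩

theorem tendsto_dyad : Tendsto dyad atTop (𝓝[>] (0:ℝ)) := by
  refine tendsto_nhdsWithin_iff.2 ⟨?_, Filter.Eventually.of_forall dyad_pos⟩
  exact tendsto_inv_atTop_zero.comp (tendsto_pow_atTop_atTop_of_one_lt one_lt_two)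

/-- The axis pair `(0, s e₀)`. [folklore] -/
abbrev cfg0 (s : ℝ) : Fin 2 → EuclideanSpace ℝ (Fin 3) := ![0, EuclideanSpace.single 0 s]

/-- The pinned zoom. [folklore] -/
abbrev pz (n : ℕ) (δ : ℝ) (x : Fin n → EuclideanSpace ℝ (Fin 3)) : ℝ :=
  rescaledCorrelator (criticalCorr 3) rhoPin n δ x

/-! ### The pinned zoom at axis pairs -/

theorem pz_two_cfg0 (δ s : ℝ) :
    pz 2 δ (cfg0 s) = criticalTwoPoint 3 (Pi.single 0 ⌊s / δ⌋) / criticalTwoPoint 3 (Pi.single 0 ⌊1 / δ⌋) :=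
  rescaled_pin_cfg0s δ s

theorem pz_two_cfg0_pos (δ s : ℝ) : 0 < pz 2 δ (cfg0 s) := by
  rw [pz_two_cfg0]
  exact div_pos (criticalTwoPoint_pos3 _) (criticalTwoPoint_pos3 _)

/-- Axis monotonicity (Messager–Miracle-Solé): `G(⌊a⌋e₀) ≤ G(⌊b⌋e₀)` for `0 ≤ b ≤ a`. [folklore] -/
theorem criticalTwoPoint_floor_antitone {a b : ℝ} (hb : 0 ≤ b) (hab : b ≤ a) :
    criticalTwoPoint 3 (Pi.single 0 ⌊a⌋) ≤ criticalTwoPoint 3 (Pi.single 0 ⌊b⌋) := by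
  have ha0 : 0 ≤ ⌊a⌋ := Int.floor_nonneg.2 (hb.trans hab)
  have hb0 : 0 ≤ ⌊b⌋ := Int.floor_nonneg.2 hb
  have h := criticalTwoPoint_axis_antitone (Int.toNat_le_toNat (Int.floor_le_floor hab))
  simp only at h
  rwa [Int.toNat_of_nonneg ha0, Int.toNat_of_nonneg hb0] at h

/-- For `s ≥ 1` (and `δ > 0`) the pinned pair ratio is `≤ 1`. [folklore] -/
theorem pz_two_cfg0_le_one {δ s : ℝ} (hδ : 0 < δ) (hs : 1 ≤ s) : pz 2 δ (cfg0 s) ≤ 1 := by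
  rw [pz_two_cfg0, div_le_one (criticalTwoPoint_pos3 _)]
  exact criticalTwoPoint_floor_antitone (by positivity) (div_le_div_of_nonneg_right hs hδ.le)

/-- The pinned pair ratio is non-increasing in `s ≥ 0`. [folklore] -/
theorem pz_two_cfg0_anti {δ s s' : ℝ} (hδ : 0 < δ) (hs : 0 ≤ s) (hss' : s ≤ s') :
    pz 2 δ (cfg0 s') ≤ pz 2 δ (cfg0 s) := by
  rw [pz_two_cfg0, pz_two_cfg0]
  exact div_le_div_of_nonneg_right
    (criticalTwoPoint_floor_antitone (by positivity) (div_le_div_of_nonneg_right hss' hδ.le))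
    (criticalTwoPoint_pos3 _).le

/-! ### The exact scale identity of the pinned zoom -/

/-- `ρ_pin(δ/s)ⁿ = (pz₂(δ)(0, s e₀))^{-n/2} ρ_pin(δ)ⁿ` for `s, δ > 0`. [folklore] -/
theorem rhoPin_pow_scale {s δ : ℝ} (hs : 0 < s) (hδ : 0 < δ) (n : ℕ) :
    rhoPin (s⁻¹ * δ) ^ n = (pz 2 δ (cfg0 s)) ^ (-(n:ℝ) / 2) * rhoPin δ ^ n := by
  rw [pz_two_cfg0]
  have e : (1:ℝ) / (s⁻¹ * δ) = s / δ := by field_simp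
  unfold rhoPin
  rw [e]
  set A := criticalTwoPoint 3 (Pi.single 0 ⌊s / δ⌋) with hA
  set B := criticalTwoPoint 3 (Pi.single 0 ⌊1 / δ⌋) with hB
  have hA0 : 0 < A := criticalTwoPoint_pos3 _
  have hB0 : 0 < B := criticalTwoPoint_pos3 _
  rw [← Real.rpow_natCast (A ^ (-(1/2:ℝ))) n, ← Real.rpow_mul hA0.le,
    ← Real.rpow_natCast (B ^ (-(1/2:ℝ))) n, ← Real.rpow_mul hB0.le,
    Real.div_rpow hA0.le hB0.le]
  have h1 : (-(1/2:ℝ)) * n = -(n:ℝ) / 2 := by ring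
  rw [h1, div_eq_mul_inv (A ^ (-(n:ℝ)/2)), ← Real.rpow_neg hB0.le, neg_div, neg_neg, mul_assoc,
    ← Real.rpow_add hB0]
  have h2 : (n:ℝ) / 2 + -((n:ℝ) / 2) = 0 := by ring
  rw [show -(↑n / 2) = -((n:ℝ)/2) by ring] -- normalise
  rw [h2, Real.rpow_zero, mul_one]

/-- **Exact scale identity**: `pz n (δ/s) x = (pz 2 δ (0, s e₀))^{-n/2} · pz n δ (s·x)` — the zoom
at the finer mesh `δ/s` is the zoom at mesh `δ` of the dilated configuration, re-pinned. [folklore] -/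
theorem pz_scale {s δ : ℝ} (hs : 0 < s) (hδ : 0 < δ) (n : ℕ) (x : Fin n → EuclideanSpace ℝ (Fin 3)) :
    pz n (s⁻¹ * δ) x = (pz 2 δ (cfg0 s)) ^ (-(n:ℝ) / 2) * pz n δ (fun i => s • x i) := by
  unfold pz
  rw [rescaledCorrelator_apply, rescaledCorrelator_apply, rhoPin_pow_scale hs hδ n, mul_assoc]
  congr 2
  congr 1
  funext i
  have h := latticeApprox_smul_smul (inv_pos.2 hs) δ (s • x i)
  rw [smul_smul, inv_mul_cancel₀ hs.ne', one_smul] at h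
  exact h

/-! ### Configurations: dilated reference pair, compact images -/

theorem smul_cfg01 (s : ℝ) : (fun i => s • (cfg0 1) i) = cfg0 s := by
  funext i
  fin_cases i
  · simp
  · simp only [Matrix.cons_val_one, Matrix.cons_val_fin_one, Fin.mk_one]
    ext j
    by_cases hj : j = 0
    · subst hj; simp
    · simp [hj]

theorem cfg0_mem {s : ℝ} (hs : s ≠ 0) : cfg0 s ∈ NonCoincident 3 2 :=
  zero_unitVec_mem_nonCoincident hs

/-- The value of a scale-covariant dyadic limit on the axis: `S₂(0, s e₀) = s^{-2Δ}` (given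
`S₂(0,e₀) = 1`). [folklore] -/
theorem two_cfg0_eq {S : CorrFamily 3} {Δ : ℝ} (h1 : S 2 (cfg0 1) = 1)
    (hsc : ∀ (n : ℕ) (c : ℝ), 0 < c → ∀ x ∈ NonCoincident 3 n,
      S n (fun i => c • x i) = c ^ (-(n:ℝ) * Δ) * S n x) {s : ℝ} (hs : 0 < s) :
    S 2 (cfg0 s) = s ^ (-(2:ℝ) * Δ) := by
  have h := hsc 2 s hs _ (cfg0_mem one_ne_zero)
  rw [smul_cfg01, h1, mul_one] at h
  exact_mod_cast h

/-! ### crux ⟹ dyadic convergence to a scale-covariant limit -/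

/-- The pinned zoom converges along the full filter under a witness (cf. `PinnedForm`). [folklore] -/
theorem hasPointwiseScalingLimit_rhoPin {ρ : ℝ → ℝ} {S' : CorrFamily 3}
    (hρ : ∀ δ ∈ Set.Ioc (0:ℝ) 1, 0 < ρ δ)
    (hlim : HasPointwiseScalingLimit (criticalCorr 3) ρ S') (hnd : IsNondegenerateTwoPoint S') :
    HasPointwiseScalingLimit (criticalCorr 3) rhoPin
      (fun n x => ((S' 2 (cfg0 1)) ^ (-(1 / 2 : ℝ))) ^ n * S' n x) := by
  intro n
  have hA : 0 < S' 2 (cfg0 1) := hnd _ cfg01_mem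
  set r : ℝ → ℝ := fun δ => (rescaledCorrelator (criticalCorr 3) ρ 2 δ (cfg0 1)) ^ (-(1 / 2 : ℝ)) with hr
  have hr_t : Tendsto (fun δ => r δ ^ n) (𝓝[>] (0:ℝ)) (𝓝 (((S' 2 (cfg0 1)) ^ (-(1 / 2 : ℝ))) ^ n)) :=
    ((((hlim 2).tendsto_at cfg01_mem).rpow_const (p := -(1 / 2 : ℝ)) (Or.inl hA.ne')).pow n)
  have hF1 : TendstoLocallyUniformlyOn (fun δ (_ : Fin n → EuclideanSpace ℝ (Fin 3)) => r δ ^ n)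
      (fun _ => ((S' 2 (cfg0 1)) ^ (-(1 / 2 : ℝ))) ^ n) (𝓝[>] (0:ℝ)) (NonCoincident 3 n) :=
    (hr_t.tendstoUniformlyOn_const (NonCoincident 3 n)).tendstoLocallyUniformlyOn
  have hprod := hF1.mul₀_of_isBoundedUnder (hlim n)
    (fun x _ => isBoundedUnder_of ⟨dist (((S' 2 (cfg0 1)) ^ (-(1 / 2 : ℝ))) ^ n) 0, fun _ => le_rfl⟩)
    (fun x hx => limit_isBoundedUnder hlim n hx)
  refine hprod.congr_inseparable ?_
  filter_upwards [Ioc_mem_nhdsGT one_pos] with δ hδ x _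
  exact Inseparable.of_eq (rescaled_pin_eq (hρ δ hδ) n x).symm

theorem rhoPin_pos (δ : ℝ) : 0 < rhoPin δ := Real.rpow_pos_of_pos (criticalTwoPoint_pos3 _) _

/-- **crux ⟹ the dyadic pinned zoom converges (all `n`, locally uniformly off the diagonals) to a
limit which is scale covariant on non-coincident configurations.** [folklore] -/
theorem dyadic_of_crux (h : HyperoctahedralRP.ExistsScaleCovariantLimit) :
    ∃ S : CorrFamily 3, (∀ n, TendstoLocallyUniformlyOn (fun k => pz n (dyad k)) (S n) atTop
      (NonCoincident 3 n)) ∧ ∃ Δ : ℝ, ∀ (n : ℕ) (c : ℝ), 0 < c → ∀ x ∈ NonCoincident 3 n,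
        S n (fun i => c • x i) = c ^ (-(n:ℝ) * Δ) * S n x := by
  obtain ⟨ρ, Δ₀, S', hρ, -, hlim', -, hnd', -, -⟩ := h
  have hlim := hasPointwiseScalingLimit_rhoPin hρ hlim' hnd'
  set S : CorrFamily 3 := fun n x => ((S' 2 (cfg0 1)) ^ (-(1 / 2 : ℝ))) ^ n * S' n x with hS
  have hρ' : ∀ δ ∈ Set.Ioc (0:ℝ) 1, 0 < rhoPin δ := fun δ _ => rhoPin_pos δ
  have h1 : S 2 (cfg0 1) = 1 := by
    have h := (hlim 2).tendsto_at cfg01_mem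
    have h' : Tendsto (fun δ : ℝ => (1:ℝ)) (𝓝[>] (0:ℝ)) (𝓝 (S 2 (cfg0 1))) :=
      h.congr fun δ => rescaled_pin_cfg01 δ
    exact (tendsto_nhds_unique tendsto_const_nhds h').symm
  have hnd : IsNondegenerateTwoPoint S :=
    (isNondegenerateTwoPoint_iff_exists_pos hlim).2 ⟨_, cfg01_mem, by rw [h1]; exact one_pos⟩
  obtain ⟨Δ, -, hcov⟩ := hlim.exists_rpow_scale (by norm_num) hρ' hnd
  exact ⟨S, fun n => tendstoLocallyUniformlyOn_comp_tendsto (hlim n) tendsto_dyad, Δ, hcov⟩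

/-! ### The converse: dyadic convergence + scale covariance ⟹ full-filter convergence -/

/-- Dyadic decomposition of a mesh: `δ = s⁻¹ 2^{-k}` with `s ∈ [1,2)` and `k = ⌊log₂ δ⁻¹⌋`; if
`δ < 2^{-K₀}` then `k ≥ K₀`. [folklore] -/
theorem dyadic_decomposition {δ : ℝ} (hδ : 0 < δ) (hδ1 : δ < 1) (K₀ : ℕ) (hK : δ < dyad K₀) :
    ∃ (k : ℕ) (s : ℝ), K₀ ≤ k ∧ 1 ≤ s ∧ s < 2 ∧ δ = s⁻¹ * dyad k := by
  set L : ℝ := Real.logb 2 δ⁻¹ with hL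
  have hδi : 1 < δ⁻¹ := one_lt_inv₀ hδ |>.2 hδ1
  have hL0 : 0 ≤ L := (Real.logb_pos one_lt_two hδi).le
  set k : ℕ := ⌊L⌋₊ with hk
  have hk1 : (k:ℝ) ≤ L := Nat.floor_le hL0
  have hk2 : L < (k:ℝ) + 1 := Nat.lt_floor_add_one L
  -- `2^k ≤ δ⁻¹ < 2^(k+1)`
  have hlo : (2:ℝ) ^ k ≤ δ⁻¹ := by
    have := (Real.le_logb_iff_rpow_le one_lt_two (inv_pos.2 hδ)).1 hk1
    rwa [Real.rpow_natCast] at this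
  have hhi : δ⁻¹ < (2:ℝ) ^ (k + 1) := by
    have hk2' : L < ((k + 1 : ℕ) : ℝ) := by push_cast; exact hk2
    have := (Real.logb_lt_iff_lt_rpow one_lt_two (inv_pos.2 hδ)).1 hk2'
    rwa [Real.rpow_natCast] at this
  refine ⟨k, δ⁻¹ * dyad k, ?_, ?_, ?_, ?_⟩
  · -- `K₀ ≤ k` from `δ < 2^{-K₀}`
    have hK' : (K₀:ℝ) ≤ L := by
      have h2 : (2:ℝ) ^ K₀ < δ⁻¹ := by
        rw [lt_inv_comm₀ (by positivity) hδ]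
        exact hK
      have := (Real.lt_logb_iff_rpow_lt one_lt_two (inv_pos.2 hδ)).2 (by rwa [Real.rpow_natCast])
      exact this.le
    exact Nat.le_floor hK'
  · unfold dyad
    rw [le_mul_inv_iff₀ (by positivity), one_mul]
    exact hlo
  · unfold dyad
    rw [mul_inv_lt_iff₀ (by positivity), pow_succ] at *
    linarith [hhi]
  · have hd : dyad k ≠ 0 := (dyad_pos k).ne'
    field_simp

/-- **Dyadic convergence to a scale-covariant limit ⟹ the pinned zoom converges along the FULL
filter** (to the same limit). The two dyadic inputs — uniform convergence of `pz n (2^{-k})` on the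
compact set of dilates `{s·x : s ∈ [1,2], x ∈ K}` and of `pz 2 (2^{-k})` on the axis arc
`{(0, s e₀) : s ∈ [1,2]}` — control `pz n (s⁻¹2^{-k}) x = pz₂(2^{-k})(0,se₀)^{-n/2} pz n (2^{-k})(s·x)`
uniformly; scale covariance makes the limit `s^{nΔ} S n (s·x) = S n x` independent of `s`. [folklore] -/
theorem pinnedLimit_of_dyadic {S : CorrFamily 3} {Δ : ℝ}
    (hdy : ∀ n, TendstoLocallyUniformlyOn (fun k => pz n (dyad k)) (S n) atTop (NonCoincident 3 n))
    (hsc : ∀ (n : ℕ) (c : ℝ), 0 < c → ∀ x ∈ NonCoincident 3 n,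
      S n (fun i => c • x i) = c ^ (-(n:ℝ) * Δ) * S n x) :
    HasPointwiseScalingLimit (criticalCorr 3) rhoPin S := by
  -- the value `S₂(0,e₀) = 1`, the axis law, `Δ ≥ 0`
  have h1 : S 2 (cfg0 1) = 1 := by
    have h := (hdy 2).tendsto_at cfg01_mem
    have h' : Tendsto (fun k : ℕ => (1:ℝ)) atTop (𝓝 (S 2 (cfg0 1))) :=
      h.congr fun k => rescaled_pin_cfg01 (dyad k)
    exact (tendsto_nhds_unique tendsto_const_nhds h').symm
  have hax : ∀ s : ℝ, 0 < s → S 2 (cfg0 s) = s ^ (-(2:ℝ) * Δ) := fun s hs => two_cfg0_eq h1 hsc hs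
  have hΔ : 0 ≤ Δ := by
    by_contra hneg
    push Not at hneg
    have hle : S 2 (cfg0 2) ≤ 1 :=
      le_of_tendsto ((hdy 2).tendsto_at (cfg0_mem (s := 2) two_ne_zero))
        (Filter.Eventually.of_forall fun k => pz_two_cfg0_le_one (dyad_pos k) one_le_two)
    rw [hax 2 two_pos] at hle
    have : (1:ℝ) < (2:ℝ) ^ (-(2:ℝ) * Δ) := Real.one_lt_rpow one_lt_two (by nlinarith)
    linarith
  -- the lower bound `m` of the pinned pair ratio on the window
  have hm0 : 0 < (2:ℝ) ^ (-(2:ℝ) * Δ) := Real.rpow_pos_of_pos two_pos _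
  set m : ℝ := (2:ℝ) ^ (-(2:ℝ) * Δ) with hm
  have hev_m : ∀ᶠ k in atTop, m / 2 < pz 2 (dyad k) (cfg0 2) := by
    have h := (hdy 2).tendsto_at (cfg0_mem (s := 2) two_ne_zero)
    rw [hax 2 two_pos] at h
    exact h.eventually_const_lt (by linarith)
  intro n
  rw [tendstoLocallyUniformlyOn_iff_forall_isCompact (isOpen_nonCoincident 3 n)]
  intro K hKs hKc
  rw [Metric.tendstoUniformlyOn_iff]
  intro ε hε
  -- compact set of dilates
  have hgc : Continuous (fun p : ℝ × (Fin n → EuclideanSpace ℝ (Fin 3)) => fun i => p.1 • p.2 i) :=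
    continuous_pi fun i => continuous_fst.smul ((continuous_apply i).comp continuous_snd)
  set C : Set (Fin n → EuclideanSpace ℝ (Fin 3)) :=
    (fun p : ℝ × (Fin n → EuclideanSpace ℝ (Fin 3)) => fun i => p.1 • p.2 i) '' (Set.Icc (1:ℝ) 2 ×ˢ K)
    with hC
  have hCc : IsCompact C := (isCompact_Icc.prod hKc).image hgc
  have hCs : C ⊆ NonCoincident 3 n := by
    rintro _ ⟨⟨s, x⟩, ⟨hs, hx⟩, rfl⟩
    exact smul_mem_nonCoincident (by linarith [hs.1] : s ≠ 0) (hKs hx)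
  have hUC := (tendstoLocallyUniformlyOn_iff_forall_isCompact (isOpen_nonCoincident 3 n)).1
    (hdy n) C hCs hCc
  -- compact axis arc
  set A : Set (Fin 2 → EuclideanSpace ℝ (Fin 3)) :=
    (fun s : ℝ => (fun i => s • (cfg0 1) i)) '' Set.Icc (1:ℝ) 2 with hA
  have hAc : IsCompact A :=
    isCompact_Icc.image (continuous_pi fun i => continuous_id.smul continuous_const)
  have hAs : A ⊆ NonCoincident 3 2 := by
    rintro _ ⟨s, hs, rfl⟩
    show (fun i => s • (cfg0 1) i) ∈ NonCoincident 3 2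
    rw [smul_cfg01]
    exact cfg0_mem (by linarith [hs.1])
  have hUA := (tendstoLocallyUniformlyOn_iff_forall_isCompact (isOpen_nonCoincident 3 2)).1
    (hdy 2) A hAs hAc
  -- a bound `M` for `|S n|` on `C`
  obtain ⟨k₂, hk₂⟩ := ((Metric.tendstoUniformlyOn_iff.1 hUC) 1 one_pos).exists_forall_of_atTop
  set M : ℝ := |rhoPin (dyad k₂)| ^ n + 1 with hM
  have hM0 : 0 < M := by positivity
  have hSM : ∀ y ∈ C, |S n y| ≤ M := by
    intro y hy
    have h := hk₂ k₂ le_rfl y hy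
    rw [Real.dist_eq] at h
    have h2 : |pz n (dyad k₂) y| ≤ |rhoPin (dyad k₂)| ^ n := abs_rescaledCorrelator_le rhoPin n (dyad k₂) y
    have h3 : |S n y| - |pz n (dyad k₂) y| ≤ |S n y - pz n (dyad k₂) y| :=
      abs_sub_abs_le_abs_sub (S n y) (pz n (dyad k₂) y)
    have h' : |S n y - pz n (dyad k₂) y| < 1 := h
    show |S n y| ≤ |rhoPin (dyad k₂)| ^ n + 1
    linarith
  -- the re-pinning function `φ(t) = t^{-n/2}` on `[m/2, 1]`: bounded by `L`, uniformly continuous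
  set φ : ℝ → ℝ := fun t => t ^ (-(n:ℝ) / 2) with hφ
  have hexp : -(n:ℝ) / 2 ≤ 0 := by
    have : (0:ℝ) ≤ n := n.cast_nonneg
    linarith
  set L : ℝ := (m / 2) ^ (-(n:ℝ) / 2) with hL
  have hL0 : 0 < L := Real.rpow_pos_of_pos (by linarith) _
  have hφL : ∀ t, m / 2 ≤ t → φ t ≤ L := fun t ht =>
    Real.rpow_le_rpow_of_nonpos (by linarith) ht hexp
  have hφ0 : ∀ t, 0 < t → 0 < φ t := fun t ht => Real.rpow_pos_of_pos ht _
  have hφc : UniformContinuousOn φ (Set.Icc (m / 2) 1) := by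
    refine isCompact_Icc.uniformContinuousOn_of_continuous (fun t ht => ?_)
    exact (Real.continuousAt_rpow_const _ _ (Or.inl (by linarith [ht.1] : t ≠ 0))).continuousWithinAt
  have hεM : 0 < ε / (2 * (M + 1)) := by positivity
  obtain ⟨η, hη, hηφ⟩ := (Metric.uniformContinuousOn_iff.1 hφc) (ε / (2 * (M + 1))) hεM
  -- thresholds
  have hεL : 0 < ε / (2 * L) := by positivity
  obtain ⟨k₃, hk₃⟩ := ((Metric.tendstoUniformlyOn_iff.1 hUC) (ε / (2 * L)) hεL).exists_forall_of_atTop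
  have hηm : 0 < min η (m / 2) := lt_min hη (by linarith)
  obtain ⟨k₄, hk₄⟩ := ((Metric.tendstoUniformlyOn_iff.1 hUA) (min η (m / 2)) hηm).exists_forall_of_atTop
  obtain ⟨k₁, hk₁⟩ := hev_m.exists_forall_of_atTop
  set K₀ : ℕ := max (max k₁ k₂) (max k₃ k₄) with hK₀
  -- conclude along the full filter
  have hmin : 0 < min (dyad K₀) 1 := lt_min (dyad_pos K₀) one_pos
  filter_upwards [Ioo_mem_nhdsGT hmin] with δ hδ x hx
  have hδ0 : 0 < δ := hδ.1
  have hδ1 : δ < 1 := hδ.2.trans_le (min_le_right _ _)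
  have hδK : δ < dyad K₀ := hδ.2.trans_le (min_le_left _ _)
  obtain ⟨k, s, hkK, hs1, hs2, rfl⟩ := dyadic_decomposition hδ0 hδ1 K₀ hδK
  have hs0 : 0 < s := by linarith
  have hk1 : k₁ ≤ k := le_trans ((le_max_left _ _).trans (le_max_left _ _)) hkK
  have hk2' : k₂ ≤ k := le_trans ((le_max_right _ _).trans (le_max_left _ _)) hkK
  have hk3' : k₃ ≤ k := le_trans ((le_max_left _ _).trans (le_max_right _ _)) hkK
  have hk4' : k₄ ≤ k := le_trans ((le_max_right _ _).trans (le_max_right _ _)) hkK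
  -- the dilated configuration and the two bases `a` (lattice) and `b` (limit)
  have hyC : (fun i => s • x i) ∈ C := ⟨⟨s, x⟩, ⟨⟨hs1, hs2.le⟩, hx⟩, rfl⟩
  have hsA : cfg0 s ∈ A := ⟨s, ⟨hs1, hs2.le⟩, smul_cfg01 s⟩
  have ha_lo : m / 2 ≤ pz 2 (dyad k) (cfg0 s) :=
    ((hk₁ k hk1).le).trans (pz_two_cfg0_anti (dyad_pos k) hs0.le hs2.le)
  have ha_hi : pz 2 (dyad k) (cfg0 s) ≤ 1 := pz_two_cfg0_le_one (dyad_pos k) hs1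
  have hab : |S 2 (cfg0 s) - pz 2 (dyad k) (cfg0 s)| < min η (m / 2) := by
    have := hk₄ k hk4' _ hsA
    rwa [Real.dist_eq] at this
  have hb_lo : m / 2 ≤ S 2 (cfg0 s) := by
    rw [hax s hs0]
    have : m ≤ s ^ (-(2:ℝ) * Δ) := by
      rw [hm]
      exact Real.rpow_le_rpow_of_nonpos hs0 hs2.le (by nlinarith)
    linarith
  have hb_hi : S 2 (cfg0 s) ≤ 1 := by
    rw [hax s hs0]
    exact Real.rpow_le_one_of_one_le_of_nonpos hs1 (by nlinarith)
  -- the scale identity and the covariance of the limit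
  have hid : pz n (s⁻¹ * dyad k) x = φ (pz 2 (dyad k) (cfg0 s)) * pz n (dyad k) (fun i => s • x i) :=
    pz_scale hs0 (dyad_pos k) n x
  have hcov : S n x = φ (S 2 (cfg0 s)) * S n (fun i => s • x i) := by
    have e := hsc n s hs0 x (hKs hx)
    have hφb : φ (S 2 (cfg0 s)) = s ^ ((n:ℝ) * Δ) := by
      show (S 2 (cfg0 s)) ^ (-(n:ℝ) / 2) = s ^ ((n:ℝ) * Δ)
      rw [hax s hs0, ← Real.rpow_mul hs0.le]
      congr 1; ring
    have hprod : s ^ ((n:ℝ) * Δ) * s ^ (-(n:ℝ) * Δ) = 1 := by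
      rw [← Real.rpow_add hs0]
      have h0 : (n:ℝ) * Δ + -(n:ℝ) * Δ = 0 := by ring
      rw [h0, Real.rpow_zero]
    rw [hφb, e, ← mul_assoc, hprod, one_mul]
  -- the estimate
  show dist (S n x) (pz n (s⁻¹ * dyad k) x) < ε
  rw [Real.dist_eq, hid, hcov]
  set a : ℝ := pz 2 (dyad k) (cfg0 s) with ha
  set b : ℝ := S 2 (cfg0 s) with hb
  set P : ℝ := pz n (dyad k) (fun i => s • x i) with hP
  set Q : ℝ := S n (fun i => s • x i) with hQ
  have hPQ : |Q - P| < ε / (2 * L) := by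
    have := hk₃ k hk3' _ hyC
    rwa [Real.dist_eq] at this
  have hPM : |P| ≤ M + 1 := by
    have h := hk₂ k hk2' _ hyC
    rw [Real.dist_eq] at h
    have h' : |Q - P| < 1 := h
    have := abs_sub_abs_le_abs_sub P Q
    rw [abs_sub_comm] at this
    linarith [hSM _ hyC]
  have hφab : |φ a - φ b| < ε / (2 * (M + 1)) := by
    have h := hηφ a ⟨ha_lo, ha_hi⟩ b ⟨hb_lo, hb_hi⟩ (by
      rw [Real.dist_eq, abs_sub_comm]; exact hab.trans_le (min_le_left _ _))
    rwa [Real.dist_eq] at h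
  have hφbL : |φ b| ≤ L := by
    rw [abs_of_pos (hφ0 b (by linarith))]
    exact hφL b hb_lo
  have t1 : |φ b - φ a| * |P| ≤ ε / (2 * (M + 1)) * (M + 1) := by
    rw [abs_sub_comm]
    exact mul_le_mul hφab.le hPM (abs_nonneg _) hεM.le
  have t2 : |φ b| * |Q - P| ≤ L * |Q - P| := mul_le_mul_of_nonneg_right hφbL (abs_nonneg _)
  have t3 : L * |Q - P| < L * (ε / (2 * L)) := mul_lt_mul_of_pos_left hPQ hL0
  have e1 : ε / (2 * (M + 1)) * (M + 1) = ε / 2 := by field_simp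
  have e2 : L * (ε / (2 * L)) = ε / 2 := by field_simp
  calc |φ b * Q - φ a * P|
      = |(φ b - φ a) * P + φ b * (Q - P)| := by ring_nf
    _ ≤ |φ b - φ a| * |P| + |φ b| * |Q - P| := by
        refine (abs_add_le _ _).trans ?_
        rw [abs_mul, abs_mul]
    _ < ε / 2 + ε / 2 := by linarith
    _ = ε := by ring

/-! ### Packaging -/

open Classical in
/-- The pinned limit gives the crux (non-degeneracy from `S₂(0,e₀) = 1`; other clauses free). [folklore] -/
theorem crux_of_pinnedLimit {S : CorrFamily 3}
    (hlim : HasPointwiseScalingLimit (criticalCorr 3) rhoPin S) :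
    HyperoctahedralRP.ExistsScaleCovariantLimit := by
  have h1 : S 2 (cfg0 1) = 1 := by
    have h := (hlim 2).tendsto_at cfg01_mem
    have h' : Tendsto (fun δ : ℝ => (1:ℝ)) (𝓝[>] (0:ℝ)) (𝓝 (S 2 (cfg0 1))) :=
      h.congr fun δ => rescaled_pin_cfg01 δ
    exact (tendsto_nhds_unique tendsto_const_nhds h').symm
  have hnd : IsNondegenerateTwoPoint S :=
    (isNondegenerateTwoPoint_iff_exists_pos hlim).2 ⟨_, cfg01_mem, by rw [h1]; exact one_pos⟩
  have hρ : ∀ δ ∈ Set.Ioc (0:ℝ) 1, 0 < rhoPin δ := fun δ _ => rhoPin_pos δ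
  obtain ⟨Δ, hwin, hsc⟩ := exists_scaleCovariant_normalised hρ hlim hnd
  exact ⟨rhoPin, Δ, fun n x => if x ∈ NonCoincident 3 n then S n x else 0, hρ, by linarith [hwin.1],
    normalised_hasLimit hlim, fun n z hz => if_neg hz, normalised_nondeg hnd,
    isTranslationInvariant_normalised_of_limit hlim, hsc⟩

/-- **crux ⟺ THE DYADIC PINNED ZOOM CONVERGES TO A SCALE-COVARIANT LIMIT.** Convergence along the
single geometric mesh sequence `2^{-k}` (every `n`, locally uniformly off the diagonals) of the
renormalisation-free pinned zoom, PLUS scale covariance of that limit on non-coincident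
configurations under ALL dilations, is equivalent to the crux. The second clause is load-bearing:
a discretely self-similar pair function has the first without the second
(`Literature/…/PointwiseScalingLimitDiscreteScaleInvariance.lean`, `dsi_dyadic_tendsto` /
`dsiLimitTwo_not_three_covariant`). [folklore] -/
theorem crux_iff_dyadic :
    HyperoctahedralRP.ExistsScaleCovariantLimit ↔
      ∃ S : CorrFamily 3, (∀ n, TendstoLocallyUniformlyOn (fun k => pz n (dyad k)) (S n) atTop
        (NonCoincident 3 n)) ∧ ∃ Δ : ℝ, ∀ (n : ℕ) (c : ℝ), 0 < c → ∀ x ∈ NonCoincident 3 n,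
          S n (fun i => c • x i) = c ^ (-(n:ℝ) * Δ) * S n x :=
  ⟨dyadic_of_crux, fun ⟨_, hdy, _, hsc⟩ => crux_of_pinnedLimit (pinnedLimit_of_dyadic hdy hsc)⟩

/-- **Dyadic self-consistency is automatic**: ANY dyadic limit of the pinned zoom satisfies
`S n x = S₂(0, 2e₀)^{-n/2} · S n (2·x)` on non-coincident `x` (the mesh `2^{-(k+1)}` is the mesh
`2^{-k}` of the doubled configuration, re-pinned). So covariance under the dilation `2` carries no
information; the content of the second clause of `crux_iff_dyadic` is covariance under non-dyadic
dilations. [folklore] -/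
theorem dyadicLimit_two_selfConsistent {S : CorrFamily 3}
    (hdy : ∀ n, TendstoLocallyUniformlyOn (fun k => pz n (dyad k)) (S n) atTop (NonCoincident 3 n))
    {n : ℕ} {x : Fin n → EuclideanSpace ℝ (Fin 3)} (hx : x ∈ NonCoincident 3 n)
    (h2 : S 2 (cfg0 2) ≠ 0) :
    S n x = (S 2 (cfg0 2)) ^ (-(n:ℝ) / 2) * S n (fun i => (2:ℝ) • x i) := by
  have hx2 : (fun i => (2:ℝ) • x i) ∈ NonCoincident 3 n := smul_mem_nonCoincident two_ne_zero hx
  -- along `k+1`: `pz n (dyad (k+1)) x = (pz 2 (dyad k) (0,2e₀))^{-n/2} pz n (dyad k) (2x)`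
  have hid : ∀ k, pz n (dyad (k + 1)) x =
      (pz 2 (dyad k) (cfg0 2)) ^ (-(n:ℝ) / 2) * pz n (dyad k) (fun i => (2:ℝ) • x i) := by
    intro k
    have h := pz_scale (s := 2) two_pos (dyad_pos k) n x
    have e : (2:ℝ)⁻¹ * dyad k = dyad (k + 1) := by unfold dyad; rw [pow_succ, mul_inv, mul_comm]
    rw [e] at h
    exact h
  have hL : Tendsto (fun k => pz n (dyad (k + 1)) x) atTop (𝓝 (S n x)) :=
    ((hdy n).tendsto_at hx).comp (tendsto_add_atTop_nat 1)
  have hR : Tendsto (fun k => (pz 2 (dyad k) (cfg0 2)) ^ (-(n:ℝ) / 2) * pz n (dyad k) (fun i => (2:ℝ) • x i))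
      atTop (𝓝 ((S 2 (cfg0 2)) ^ (-(n:ℝ) / 2) * S n (fun i => (2:ℝ) • x i))) :=
    ((((hdy 2).tendsto_at (cfg0_mem (s := 2) two_ne_zero)).rpow_const (Or.inl h2))).mul
      ((hdy n).tendsto_at hx2)
  exact tendsto_nhds_unique hL (hR.congr fun k => (hid k).symm)

/-! ## §J  Two primes fix the scale: crux ⟺ dyadic convergence + continuity + ONE triadic self-consistency -/

/-- `2^q = 3^p` for integers forces `p = q = 0`. [folklore] -/
theorem two_zpow_eq_three_zpow {p q : ℤ} (h : (2:ℝ) ^ q = (3:ℝ) ^ p) : p = 0 ∧ q = 0 := by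
  -- natural-number core: `2^a = 3^b → a = 0 ∧ b = 0`
  have core : ∀ a b : ℕ, (2:ℝ) ^ a = (3:ℝ) ^ b → a = 0 ∧ b = 0 := by
    intro a b hab
    have hnat : 2 ^ a = 3 ^ b := by exact_mod_cast hab
    rcases Nat.eq_zero_or_pos a with ha | ha
    · subst ha
      simp at hnat
      exact ⟨rfl, (Nat.pow_eq_one.1 hnat.symm).resolve_left (by norm_num)⟩
    · exfalso
      have h2 : 2 ∣ 3 ^ b := by rw [← hnat]; exact dvd_pow_self 2 ha.ne'
      have : 2 ∣ 3 := Nat.Prime.dvd_of_dvd_pow Nat.prime_two h2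
      omega
  rcases le_or_gt 0 q with hq | hq <;> rcases le_or_gt 0 p with hp | hp
  · obtain ⟨a, rfl⟩ := Int.eq_ofNat_of_zero_le hq
    obtain ⟨b, rfl⟩ := Int.eq_ofNat_of_zero_le hp
    rw [zpow_natCast, zpow_natCast] at h
    obtain ⟨ha, hb⟩ := core a b h
    exact ⟨by simp [hb], by simp [ha]⟩
  · exfalso
    have h1 : (1:ℝ) ≤ (2:ℝ) ^ q := one_le_zpow₀ one_le_two hq
    have h2 : (3:ℝ) ^ p < 1 := zpow_lt_one_of_neg₀ (by norm_num) hp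
    linarith
  · exfalso
    have h1 : (2:ℝ) ^ q < 1 := zpow_lt_one_of_neg₀ (by norm_num) hq
    have h2 : (1:ℝ) ≤ (3:ℝ) ^ p := one_le_zpow₀ (by norm_num) hp
    linarith
  · have h' : (2:ℝ) ^ (-q) = (3:ℝ) ^ (-p) := by rw [zpow_neg, zpow_neg, h]
    obtain ⟨a, ha⟩ := Int.eq_ofNat_of_zero_le (by omega : 0 ≤ -q)
    obtain ⟨b, hb⟩ := Int.eq_ofNat_of_zero_le (by omega : 0 ≤ -p)
    rw [ha, hb, zpow_natCast, zpow_natCast] at h'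
    obtain ⟨ha0, hb0⟩ := core a b h'
    omega

/-- **`{2^a 3^b}` is dense**: the additive subgroup of `ℝ` generated by `log 2` and `log 3` is dense
(it is not cyclic, by `two_zpow_eq_three_zpow`). [folklore] -/
theorem dense_closure_log_two_log_three :
    Dense ((AddSubgroup.closure ({Real.log 2, Real.log 3} : Set ℝ) : AddSubgroup ℝ) : Set ℝ) := by
  set H := (AddSubgroup.closure ({Real.log 2, Real.log 3} : Set ℝ) : AddSubgroup ℝ) with hH
  rcases AddSubgroup.dense_or_cyclic H with hd | ⟨a, ha⟩
  · exact hd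
  · exfalso
    have h2 : Real.log 2 ∈ H := AddSubgroup.subset_closure (by simp)
    have h3 : Real.log 3 ∈ H := AddSubgroup.subset_closure (by simp)
    rw [ha, AddSubgroup.mem_closure_singleton] at h2 h3
    obtain ⟨p, hp⟩ := h2
    obtain ⟨q, hq⟩ := h3
    -- `q • log 2 = p • log 3`
    have hrel : (q:ℝ) * Real.log 2 = (p:ℝ) * Real.log 3 := by
      rw [← hp, ← hq]; simp only [zsmul_eq_mul]; ring
    have hexp : (2:ℝ) ^ q = (3:ℝ) ^ p := by
      have := congrArg Real.exp hrel
      rwa [← Real.log_zpow, ← Real.log_zpow, Real.exp_log (zpow_pos two_pos _),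
        Real.exp_log (zpow_pos (by norm_num) _)] at this
    obtain ⟨hp0, hq0⟩ := two_zpow_eq_three_zpow hexp
    subst hq0
    have : Real.log 3 = 0 := by rw [← hq]; simp
    have : (0:ℝ) < Real.log 3 := Real.log_pos (by norm_num)
    linarith

/-- Powers `2^a 3^b` approximate every positive real. [folklore] -/
theorem exists_seq_two_three_tendsto {c : ℝ} (hc : 0 < c) :
    ∃ u : ℕ → ℤ × ℤ, Tendsto (fun j => (2:ℝ) ^ (u j).1 * (3:ℝ) ^ (u j).2) atTop (𝓝 c) := by
  have hd := dense_closure_log_two_log_three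
  -- `log c` is a limit of elements of the subgroup
  have hmem : Real.log c ∈ closure ((AddSubgroup.closure ({Real.log 2, Real.log 3} : Set ℝ) : AddSubgroup ℝ) : Set ℝ) :=
    hd.closure_eq.symm ▸ Set.mem_univ _
  obtain ⟨v, hv, hvt⟩ := mem_closure_iff_seq_limit.1 hmem
  -- each element of the subgroup is `a log 2 + b log 3`
  have hform : ∀ j, ∃ ab : ℤ × ℤ, v j = ab.1 * Real.log 2 + ab.2 * Real.log 3 := by
    intro j
    have := hv j
    refine AddSubgroup.closure_induction (p := fun y _ => ∃ ab : ℤ × ℤ, y = ab.1 * Real.log 2 + ab.2 * Real.log 3)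
      ?_ ?_ ?_ ?_ this
    · intro y hy
      simp only [Set.mem_insert_iff, Set.mem_singleton_iff] at hy
      rcases hy with rfl | rfl
      · exact ⟨(1, 0), by simp⟩
      · exact ⟨(0, 1), by simp⟩
    · exact ⟨(0, 0), by simp⟩
    · rintro y z _ _ ⟨ab, rfl⟩ ⟨cd, rfl⟩
      exact ⟨(ab.1 + cd.1, ab.2 + cd.2), by push_cast; ring⟩
    · rintro y _ ⟨ab, rfl⟩
      exact ⟨(-ab.1, -ab.2), by push_cast; ring⟩
  choose u hu using hform
  refine ⟨u, ?_⟩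
  have hexp : Tendsto (fun j => Real.exp (v j)) atTop (𝓝 (Real.exp (Real.log c))) :=
    (Real.continuous_exp.tendsto _).comp hvt
  rw [Real.exp_log hc] at hexp
  refine hexp.congr fun j => ?_
  rw [hu j, Real.exp_add, show ((u j).1 : ℝ) * Real.log 2 = Real.log 2 * (u j).1 by ring,
    show ((u j).2 : ℝ) * Real.log 3 = Real.log 3 * (u j).2 by ring,
    Real.exp_mul, Real.exp_mul, Real.exp_log two_pos, Real.exp_log (by norm_num : (0:ℝ) < 3),
    Real.rpow_intCast, Real.rpow_intCast]

/-! ### Two integer self-consistencies + continuity ⟹ full scale covariance -/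

section TwoThree

variable {S : CorrFamily 3}

/-- The would-be scale factor `Ψ(c) = S₂(0, c e₀)^{1/2}`. [folklore] -/
def Psi (S : CorrFamily 3) (c : ℝ) : ℝ := Real.sqrt (S 2 (cfg0 c))

/-- `c` is GOOD: `S` is exactly `Ψ(c)`-covariant under the dilation `c`. [folklore] -/
def Good (S : CorrFamily 3) (c : ℝ) : Prop :=
  0 < c ∧ 0 < Psi S c ∧ ∀ n, ∀ x ∈ NonCoincident 3 n, S n (fun i => c • x i) = (Psi S c) ^ n * S n x

theorem cfg0_smul (c s : ℝ) : (fun i => c • (cfg0 s) i) = cfg0 (c * s) := by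
  have h := smul_cfg01 (c * s)
  rw [← h, ← smul_cfg01 s]
  funext i
  simp [mul_smul]

/-- `Ψ(c)² = S₂(0, c e₀)` when the latter is `≥ 0`. [folklore] -/
theorem Psi_sq {c : ℝ} (h : 0 ≤ S 2 (cfg0 c)) : (Psi S c) ^ 2 = S 2 (cfg0 c) := Real.sq_sqrt h

/-- For a good `c`: `S₂(0, c e₀) = Ψ(c)²` (given `S₂(0,e₀) = 1`). [folklore] -/
theorem two_cfg0_of_good (h1 : S 2 (cfg0 1) = 1) {c : ℝ} (hc : Good S c) : S 2 (cfg0 c) = (Psi S c) ^ 2 := by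
  have h := hc.2.2 2 _ (cfg0_mem one_ne_zero)
  rw [cfg0_smul, mul_one, h1, mul_one] at h
  exact h

/-- Goodness from an integer self-consistency `S n x = A^{-n/2} S n (c x)`, `A = S₂(0,ce₀) > 0`. [folklore] -/
theorem good_of_selfConsistent {c : ℝ} (hc : 0 < c) (hA : 0 < S 2 (cfg0 c))
    (h : ∀ n, ∀ x ∈ NonCoincident 3 n, S n x = (S 2 (cfg0 c)) ^ (-(n:ℝ) / 2) * S n (fun i => c • x i)) :
    Good S c := by
  have hPsi : 0 < Psi S c := Real.sqrt_pos.2 hA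
  refine ⟨hc, hPsi, fun n x hx => ?_⟩
  have e := h n x hx
  have hpow : (S 2 (cfg0 c)) ^ (-(n:ℝ) / 2) * (Psi S c) ^ n = 1 := by
    unfold Psi
    rw [Real.sqrt_eq_rpow, ← Real.rpow_natCast, ← Real.rpow_mul hA.le, ← Real.rpow_add hA]
    have : -(n:ℝ) / 2 + 1 / 2 * n = 0 := by ring
    rw [this, Real.rpow_zero]
  have hne : (S 2 (cfg0 c)) ^ (-(n:ℝ) / 2) ≠ 0 := (Real.rpow_pos_of_pos hA _).ne'
  calc S n (fun i => c • x i) = ((S 2 (cfg0 c)) ^ (-(n:ℝ) / 2) * (Psi S c) ^ n) *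
        S n (fun i => c • x i) := by rw [hpow, one_mul]
    _ = (Psi S c) ^ n * ((S 2 (cfg0 c)) ^ (-(n:ℝ) / 2) * S n (fun i => c • x i)) := by ring
    _ = (Psi S c) ^ n * S n x := by rw [← e]

/-- Products of good scales are good. [folklore] -/
theorem good_mul (h1 : S 2 (cfg0 1) = 1) {c d : ℝ} (hc : Good S c) (hd : Good S d) : Good S (c * d) := by
  have hcd : 0 < c * d := mul_pos hc.1 hd.1
  have hprod : ∀ n, ∀ x ∈ NonCoincident 3 n,
      S n (fun i => (c * d) • x i) = (Psi S c * Psi S d) ^ n * S n x := by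
    intro n x hx
    have hdx : (fun i => d • x i) ∈ NonCoincident 3 n := smul_mem_nonCoincident hd.1.ne' hx
    have e1 := hc.2.2 n _ hdx
    have e2 := hd.2.2 n x hx
    simp only [mul_smul]
    rw [e1, e2, mul_pow]; ring
  have hPsi : Psi S (c * d) = Psi S c * Psi S d := by
    have h2 := hprod 2 _ (cfg0_mem one_ne_zero)
    rw [cfg0_smul, mul_one, h1, mul_one] at h2
    unfold Psi at *
    rw [h2, Real.sqrt_sq (mul_nonneg (Real.sqrt_nonneg _) (Real.sqrt_nonneg _))]
  refine ⟨hcd, ?_, fun n x hx => ?_⟩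
  · rw [hPsi]; exact mul_pos hc.2.1 hd.2.1
  · rw [hPsi]; exact hprod n x hx

/-- Inverses of good scales are good. [folklore] -/
theorem good_inv (h1 : S 2 (cfg0 1) = 1) {c : ℝ} (hc : Good S c) : Good S c⁻¹ := by
  have hci : 0 < c⁻¹ := inv_pos.2 hc.1
  have hinv : ∀ n, ∀ x ∈ NonCoincident 3 n,
      S n (fun i => c⁻¹ • x i) = ((Psi S c)⁻¹) ^ n * S n x := by
    intro n x hx
    have hcx : (fun i => c⁻¹ • x i) ∈ NonCoincident 3 n := smul_mem_nonCoincident hci.ne' hx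
    have e := hc.2.2 n _ hcx
    simp only [smul_smul, mul_inv_cancel₀ hc.1.ne', one_smul] at e
    have hne : (Psi S c) ^ n ≠ 0 := pow_ne_zero n hc.2.1.ne'
    rw [inv_pow, eq_inv_mul_iff_mul_eq₀ hne, ← e]
  have hPsi : Psi S c⁻¹ = (Psi S c)⁻¹ := by
    have h2 := hinv 2 _ (cfg0_mem one_ne_zero)
    rw [cfg0_smul, mul_one, h1, mul_one] at h2
    unfold Psi at *
    rw [h2, Real.sqrt_sq (inv_nonneg.2 (Real.sqrt_nonneg _))]
  refine ⟨hci, ?_, fun n x hx => ?_⟩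
  · rw [hPsi]; exact inv_pos.2 hc.2.1
  · rw [hPsi]; exact hinv n x hx

/-- Natural powers of good scales are good. [folklore] -/
theorem good_pow (h1 : S 2 (cfg0 1) = 1) {c : ℝ} (hc : Good S c) (m : ℕ) : Good S (c ^ m) := by
  induction m with
  | zero =>
    -- `Good S 1`
    rw [pow_zero]
    refine ⟨one_pos, ?_, fun n x _ => ?_⟩
    · unfold Psi; rw [h1, Real.sqrt_one]; exact one_pos
    · unfold Psi; rw [h1, Real.sqrt_one, one_pow, one_mul]; simp
  | succ m ih => rw [pow_succ]; exact good_mul h1 ih hc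

/-- Integer powers of good scales are good. [folklore] -/
theorem good_zpow (h1 : S 2 (cfg0 1) = 1) {c : ℝ} (hc : Good S c) (a : ℤ) : Good S (c ^ a) := by
  rcases Int.eq_nat_or_neg a with ⟨m, rfl | rfl⟩
  · rw [zpow_natCast]; exact good_pow h1 hc m
  · rw [zpow_neg, zpow_natCast]; exact good_inv h1 (good_pow h1 hc m)

/-- **Limits of good scales are good** (continuity of `S` off the diagonals). [folklore] -/
theorem good_of_tendsto (h1 : S 2 (cfg0 1) = 1) (hcont : ∀ n, ContinuousOn (S n) (NonCoincident 3 n))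
    {u : ℕ → ℝ} {c : ℝ} (hc : 0 < c) (hu : ∀ j, Good S (u j)) (hut : Tendsto u atTop (𝓝 c)) :
    Good S c := by
  -- convergence of `S n (u_j • x)` and of `Ψ(u_j)`
  have hSx : ∀ n, ∀ x ∈ NonCoincident 3 n,
      Tendsto (fun j => S n (fun i => u j • x i)) atTop (𝓝 (S n (fun i => c • x i))) := by
    intro n x hx
    have hcx : (fun i => c • x i) ∈ NonCoincident 3 n := smul_mem_nonCoincident hc.ne' hx
    have hcw : ContinuousWithinAt (S n) (NonCoincident 3 n) (fun i => c • x i) := hcont n _ hcx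
    refine hcw.tendsto.comp (tendsto_nhdsWithin_iff.2 ⟨?_, Filter.Eventually.of_forall fun j =>
      smul_mem_nonCoincident (hu j).1.ne' hx⟩)
    exact tendsto_pi_nhds.2 fun i => hut.smul tendsto_const_nhds
  have hPsi : Tendsto (fun j => Psi S (u j)) atTop (𝓝 (Psi S c)) := by
    unfold Psi
    have h := hSx 2 _ (cfg0_mem one_ne_zero)
    simp_rw [cfg0_smul, mul_one] at h
    exact h.sqrt
  have hlaw : ∀ n, ∀ x ∈ NonCoincident 3 n, S n (fun i => c • x i) = (Psi S c) ^ n * S n x := by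
    intro n x hx
    refine tendsto_nhds_unique (hSx n x hx) ?_
    have : Tendsto (fun j => (Psi S (u j)) ^ n * S n x) atTop (𝓝 ((Psi S c) ^ n * S n x)) :=
      (hPsi.pow n).mul tendsto_const_nhds
    exact this.congr fun j => ((hu j).2.2 n x hx).symm
  refine ⟨hc, ?_, hlaw⟩
  -- positivity of `Ψ(c)`: otherwise `S₂(0,e₀) = S₂(c • (0, c⁻¹e₀)) = 0`
  rcases (Real.sqrt_nonneg (S 2 (cfg0 c))).eq_or_lt with h0 | hpos
  · exfalso
    have h := hlaw 2 _ (cfg0_mem (inv_ne_zero hc.ne'))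
    rw [cfg0_smul, mul_inv_cancel₀ hc.ne', h1] at h
    unfold Psi at h
    rw [← h0] at h
    simp at h
  · exact hpos

/-- **Two primes fix the scale.** If `S₂(0,e₀) = 1`, `S` is continuous off the diagonals, and `S` is
self-consistent under the two dilations `2` and `3` (`S n x = S₂(0,ce₀)^{-n/2} S n (c·x)`, `c = 2, 3`,
with `S₂(0,2e₀), S₂(0,3e₀) > 0`), then `S` is scale covariant on non-coincident configurations with
some exponent `Δ`: every `c > 0` is good (density of `{2^a3^b}` = irrationality of `log 3/log 2`,
closedness of good scales), and a continuous multiplicative `Ψ` is a power. [folklore] -/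
theorem scaleCovariant_of_two_three (h1 : S 2 (cfg0 1) = 1)
    (hcont : ∀ n, ContinuousOn (S n) (NonCoincident 3 n))
    (hA : 0 < S 2 (cfg0 2)) (hB : 0 < S 2 (cfg0 3))
    (hC2 : ∀ n, ∀ x ∈ NonCoincident 3 n, S n x = (S 2 (cfg0 2)) ^ (-(n:ℝ) / 2) * S n (fun i => (2:ℝ) • x i))
    (hC3 : ∀ n, ∀ x ∈ NonCoincident 3 n, S n x = (S 2 (cfg0 3)) ^ (-(n:ℝ) / 2) * S n (fun i => (3:ℝ) • x i)) :
    ∃ Δ : ℝ, ∀ (n : ℕ) (c : ℝ), 0 < c → ∀ x ∈ NonCoincident 3 n,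
      S n (fun i => c • x i) = c ^ (-(n:ℝ) * Δ) * S n x := by
  have g2 : Good S 2 := good_of_selfConsistent two_pos hA hC2
  have g3 : Good S 3 := good_of_selfConsistent (by norm_num) hB hC3
  -- every `c > 0` is good
  have hall : ∀ c : ℝ, 0 < c → Good S c := by
    intro c hc
    obtain ⟨u, hu⟩ := exists_seq_two_three_tendsto hc
    exact good_of_tendsto h1 hcont hc (fun j => good_mul h1 (good_zpow h1 g2 _) (good_zpow h1 g3 _)) hu
  -- `Ψ` is multiplicative, positive, continuous on `(0,∞)`; `t ↦ log Ψ(e^t)` is additive and continuous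
  have hmul : ∀ c d, 0 < c → 0 < d → Psi S (c * d) = Psi S c * Psi S d := by
    intro c d hc hd
    have h := two_cfg0_of_good h1 (good_mul h1 (hall c hc) (hall d hd))
    have h' := (good_mul h1 (hall c hc) (hall d hd)).2.2 2 _ (cfg0_mem one_ne_zero)
    -- compare with the product law
    have e1 := (hall c hc).2.2 2 _ (smul_mem_nonCoincident hd.ne' (cfg0_mem one_ne_zero))
    have e2 := (hall d hd).2.2 2 _ (cfg0_mem one_ne_zero)
    have : (fun i => c • (fun i => d • (cfg0 1) i) i) = (fun i => (c * d) • (cfg0 1) i) := by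
      funext i; simp [mul_smul]
    rw [this] at e1
    rw [e1, e2, h1, mul_one] at h'
    -- `h' : Ψc² Ψd² = Ψ(cd)² · 1`
    rw [mul_one] at h'
    have hsq : (Psi S (c * d)) ^ 2 = (Psi S c * Psi S d) ^ 2 := by rw [← h']; ring
    have hpos1 : 0 < Psi S (c * d) := (hall _ (mul_pos hc hd)).2.1
    have hpos2 : 0 < Psi S c * Psi S d := mul_pos (hall c hc).2.1 (hall d hd).2.1
    nlinarith [sq_nonneg (Psi S (c * d) - Psi S c * Psi S d), sq_nonneg (Psi S (c * d) + Psi S c * Psi S d)]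
  have hPsi1 : Psi S 1 = 1 := by unfold Psi; rw [h1, Real.sqrt_one]
  have hcontPsi : ContinuousOn (Psi S) (Set.Ioi 0) := by
    intro c hc
    have hcx : cfg0 c ∈ NonCoincident 3 2 := cfg0_mem (ne_of_gt hc)
    have hcw : ContinuousWithinAt (S 2) (NonCoincident 3 2) (cfg0 c) := hcont 2 _ hcx
    have hmap : Tendsto (fun c' : ℝ => cfg0 c') (𝓝[Set.Ioi 0] c) (𝓝[NonCoincident 3 2] (cfg0 c)) := by
      refine tendsto_nhdsWithin_iff.2 ⟨?_, ?_⟩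
      · have : Continuous fun c' : ℝ => (fun i => c' • (cfg0 1) i) :=
          continuous_pi fun i => continuous_id.smul continuous_const
        have h := (this.tendsto c).mono_left (nhdsWithin_le_nhds (s := Set.Ioi (0:ℝ)))
        rw [smul_cfg01] at h
        exact h.congr fun c' => smul_cfg01 c'
      · filter_upwards [self_mem_nhdsWithin] with c' hc'
        exact cfg0_mem (ne_of_gt hc')
    unfold Psi
    exact (hcw.tendsto.comp hmap).sqrt
  -- the additive continuous function
  let f : ℝ →+ ℝ :=
    { toFun := fun t => Real.log (Psi S (Real.exp t))
      map_zero' := by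
        show Real.log (Psi S (Real.exp 0)) = 0
        rw [Real.exp_zero, hPsi1, Real.log_one]
      map_add' := fun s t => by
        show Real.log (Psi S (Real.exp (s + t))) = Real.log (Psi S (Real.exp s)) + Real.log (Psi S (Real.exp t))
        rw [Real.exp_add, hmul _ _ (Real.exp_pos s) (Real.exp_pos t),
          Real.log_mul (hall _ (Real.exp_pos s)).2.1.ne' (hall _ (Real.exp_pos t)).2.1.ne'] }
  have hfc : Continuous f := by
    show Continuous fun t => Real.log (Psi S (Real.exp t))
    have h1' : Continuous fun t => Psi S (Real.exp t) :=
      hcontPsi.comp_continuous Real.continuous_exp fun t => Real.exp_pos t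
    exact h1'.log fun t => (hall _ (Real.exp_pos t)).2.1.ne'
  set κ : ℝ := f 1 with hκ
  have hlin : ∀ t : ℝ, Real.log (Psi S (Real.exp t)) = t * κ := by
    intro t
    have := map_real_smul f hfc t 1
    simp only [smul_eq_mul, mul_one] at this
    exact this
  have hpow : ∀ c : ℝ, 0 < c → Psi S c = c ^ κ := by
    intro c hc
    have h := hlin (Real.log c)
    rw [Real.exp_log hc] at h
    have hP := (hall c hc).2.1
    calc Psi S c = Real.exp (Real.log (Psi S c)) := (Real.exp_log hP).symm
      _ = Real.exp (Real.log c * κ) := by rw [h]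
      _ = c ^ κ := by rw [Real.rpow_def_of_pos hc]
  refine ⟨-κ, fun n c hc x hx => ?_⟩
  rw [(hall c hc).2.2 n x hx, hpow c hc, ← Real.rpow_natCast, ← Real.rpow_mul hc.le]
  congr 1; ring

end TwoThree

/-! ### crux ⟺ dyadic convergence + continuity + triadic self-consistency -/

/-- Any dyadic limit of the pinned zoom has `S₂(0, 2e₀) > 0` (indeed `S₂(0,2e₀)·S₂(0,e₀/2) = 1`:
the zoom at mesh `2^{-(k+1)}` at `(0, e₀/2)` is the re-pinned zoom at mesh `2^{-k}` at `(0,e₀)`, which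
is `1`). So dyadic convergence already forces axis doubling to be bounded below. [folklore] -/
theorem dyadicLimit_two_cfg0_two_pos {S : CorrFamily 3}
    (hdy : ∀ n, TendstoLocallyUniformlyOn (fun k => pz n (dyad k)) (S n) atTop (NonCoincident 3 n)) :
    0 < S 2 (cfg0 2) := by
  have hhalf : cfg0 (1/2 : ℝ) ∈ NonCoincident 3 2 := cfg0_mem (by norm_num)
  have ha : Tendsto (fun k => pz 2 (dyad k) (cfg0 2)) atTop (𝓝 (S 2 (cfg0 2))) :=
    (hdy 2).tendsto_at (cfg0_mem two_ne_zero)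
  have hb : Tendsto (fun k => pz 2 (dyad (k + 1)) (cfg0 (1/2 : ℝ))) atTop (𝓝 (S 2 (cfg0 (1/2 : ℝ)))) :=
    ((hdy 2).tendsto_at hhalf).comp (tendsto_add_atTop_nat 1)
  have hid : ∀ k, pz 2 (dyad k) (cfg0 2) * pz 2 (dyad (k + 1)) (cfg0 (1/2 : ℝ)) = 1 := by
    intro k
    have h := pz_scale (s := 2) two_pos (dyad_pos k) 2 (cfg0 (1/2 : ℝ))
    have e : (2:ℝ)⁻¹ * dyad k = dyad (k + 1) := by unfold dyad; rw [pow_succ, mul_inv, mul_comm]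
    rw [e, cfg0_smul, show (2:ℝ) * (1/2) = 1 by norm_num] at h
    have h1 : pz 2 (dyad k) (cfg0 1) = 1 := rescaled_pin_cfg01 (dyad k)
    rw [h1, mul_one] at h
    rw [h]
    have hp := pz_two_cfg0_pos (dyad k) 2
    have : (pz 2 (dyad k) (cfg0 2)) ^ (-((2:ℕ):ℝ) / 2) = (pz 2 (dyad k) (cfg0 2))⁻¹ := by
      norm_num
      exact Real.rpow_neg_one _
    rw [this, mul_inv_cancel₀ hp.ne']
  have hprod : S 2 (cfg0 2) * S 2 (cfg0 (1/2 : ℝ)) = 1 :=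
    tendsto_nhds_unique (ha.mul hb) (tendsto_const_nhds.congr fun k => (hid k).symm)
  have hnn : 0 ≤ S 2 (cfg0 2) :=
    ge_of_tendsto' ha fun k => (pz_two_cfg0_pos _ _).le
  rcases hnn.eq_or_lt with h0 | hpos
  · rw [← h0, zero_mul] at hprod; exact absurd hprod zero_ne_one
  · exact hpos

/-- **crux ⟺ DYADIC CONVERGENCE + CONTINUITY + ONE TRIADIC SELF-CONSISTENCY** ("two primes fix the
scale"): the crux holds iff the pinned zoom converges along `2^{-k}` (all `n`, locally uniformly off the
diagonals) to a limit `S` that is continuous off the diagonals and satisfies the single identity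
`S n x = S₂(0,3e₀)^{-n/2} · S n (3·x)`. (The dyadic identity with `2` in place of `3` is automatic;
continuity of any full-filter limit is automatic — mesh continuity; the `3`-identity is the analogue
for the inaccessible mesh `δ/3`.) [folklore] -/
theorem crux_iff_dyadic_continuous_triadic :
    HyperoctahedralRP.ExistsScaleCovariantLimit ↔
      ∃ S : CorrFamily 3,
        (∀ n, TendstoLocallyUniformlyOn (fun k => pz n (dyad k)) (S n) atTop (NonCoincident 3 n)) ∧
        (∀ n, ContinuousOn (S n) (NonCoincident 3 n)) ∧
        (∀ n, ∀ x ∈ NonCoincident 3 n,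
          S n x = (S 2 (cfg0 3)) ^ (-(n:ℝ) / 2) * S n (fun i => (3:ℝ) • x i)) := by
  constructor
  · intro h
    obtain ⟨ρ, Δ₀, S', hρ, -, hlim', -, hnd', -, -⟩ := h
    have hlim := hasPointwiseScalingLimit_rhoPin hρ hlim' hnd'
    set S : CorrFamily 3 := fun n x => ((S' 2 (cfg0 1)) ^ (-(1 / 2 : ℝ))) ^ n * S' n x with hS
    have hρ' : ∀ δ ∈ Set.Ioc (0:ℝ) 1, 0 < rhoPin δ := fun δ _ => rhoPin_pos δ
    have h1 : S 2 (cfg0 1) = 1 := by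
      have h := (hlim 2).tendsto_at cfg01_mem
      have h' : Tendsto (fun δ : ℝ => (1:ℝ)) (𝓝[>] (0:ℝ)) (𝓝 (S 2 (cfg0 1))) :=
        h.congr fun δ => rescaled_pin_cfg01 δ
      exact (tendsto_nhds_unique tendsto_const_nhds h').symm
    have hnd : IsNondegenerateTwoPoint S :=
      (isNondegenerateTwoPoint_iff_exists_pos hlim).2 ⟨_, cfg01_mem, by rw [h1]; exact one_pos⟩
    obtain ⟨Δ, -, hcov⟩ := hlim.exists_rpow_scale (by norm_num) hρ' hnd
    refine ⟨S, fun n => tendstoLocallyUniformlyOn_comp_tendsto (hlim n) tendsto_dyad,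
      Summit.CriticalPhenomena.Ising3DConformalLimit.LimitMeshContinuity.continuousOn_limit hlim,
      fun n x hx => ?_⟩
    have e3 := hcov n 3 (by norm_num) x hx
    have h3 : S 2 (cfg0 3) = (3:ℝ) ^ (-(2:ℝ) * Δ) := two_cfg0_eq h1 hcov (by norm_num)
    rw [e3, h3, ← Real.rpow_mul (by norm_num : (0:ℝ) ≤ 3), ← mul_assoc,
      ← Real.rpow_add (by norm_num : (0:ℝ) < 3)]
    have : -(2:ℝ) * Δ * (-(n:ℝ) / 2) + -(n:ℝ) * Δ = 0 := by ring
    rw [this, Real.rpow_zero, one_mul]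
  · rintro ⟨S, hdy, hcont, hC3⟩
    have h1 : S 2 (cfg0 1) = 1 := by
      have h := (hdy 2).tendsto_at cfg01_mem
      have h' : Tendsto (fun k : ℕ => (1:ℝ)) atTop (𝓝 (S 2 (cfg0 1))) :=
        h.congr fun k => rescaled_pin_cfg01 (dyad k)
      exact (tendsto_nhds_unique tendsto_const_nhds h').symm
    have hA : 0 < S 2 (cfg0 2) := dyadicLimit_two_cfg0_two_pos hdy
    have hC2 : ∀ n, ∀ x ∈ NonCoincident 3 n,
        S n x = (S 2 (cfg0 2)) ^ (-(n:ℝ) / 2) * S n (fun i => (2:ℝ) • x i) :=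
      fun n x hx => dyadicLimit_two_selfConsistent hdy hx hA.ne'
    have hB : 0 < S 2 (cfg0 3) := by
      have hnn : 0 ≤ S 2 (cfg0 3) :=
        ge_of_tendsto' ((hdy 2).tendsto_at (cfg0_mem (by norm_num : (3:ℝ) ≠ 0)))
          fun k => (pz_two_cfg0_pos _ _).le
      rcases hnn.eq_or_lt with h0 | hpos
      · exfalso
        have h := hC3 2 _ (cfg0_mem one_ne_zero)
        rw [cfg0_smul, mul_one, h1, ← h0] at h
        norm_num at h
      · exact hpos
    obtain ⟨Δ, hsc⟩ := scaleCovariant_of_two_three h1 hcont hA hB hC2 hC3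
    exact crux_of_pinnedLimit (pinnedLimit_of_dyadic hdy hsc)

end Dyadic

end Summit.CriticalPhenomena.Ising3DConformalLimit.Cruxes.ExistsScaleCovariantLimit.Disproof

end
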